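import Literature.MathematicalPhysics.QuantumFieldTheory.Dimock2011to13.SmallFieldStepAssembly
import Literature.MathematicalPhysics.QuantumFieldTheory.Dimock2011to13.LocalizedExtraction
import Literature.MathematicalPhysics.QuantumFieldTheory.Dimock2011to13.BoundaryTermLedger

/-!
# Dimock, *The renormalization group according to Balaban* II, §3.15 "scaling" – §3.18 "final localization": the
# ASSEMBLY that closes the induction of THEOREM 3.1 (`\label{maintheorem}`) with regions — the scaling rules PROVED as
# reindexings, the coupling identification (poof) → (nugatory) with part I's recursion (recursive) BY NAME, the
# regroupings (winter)/(solstice)/(swannee)/(naval) → (representation9), the Conclusion (almonds) → (representation10),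
# and Theorem 3.1's items 1, 8, 9 (the sequences `Z_k`, `K_{k,𝚷}`, the inactive boundary bound, `V^u`) — bookkeeping PROVED

**Citation header (reproduction of PUBLISHED work; template of the Bałaban lattice Yang–Mills cell).**
J. Dimock, *The renormalization group according to Balaban. II. Large fields*, J. Math. Phys. **54** (2013) 092301
(= arXiv:1212.5562v2) [Dimock2013BalabanII]: §3.3 THEOREM 3.1 `\label{maintheorem}` TeX L2388–2539 with
(representation2) L2343–2350 and (orca) L2352–2367, its items 1 (L2393–2397), 4 (L2443–2455), 8 (L2500–2515),
9 (L2518–2536), Remark 2 with (recursive) L2553–2570; §3.8 (sugar) L3280–3290; §3.13 Remark 1 L4487–4491; §3.15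
`\subsection{scaling}` L5658–5811 ((representation8) L5800–5811); §3.16 `\subsection{the RG flow}` L5816–5975 ((poof)
L5925–5934, the two applications of (renorm5) L5935–5955, the identification L5956–5964, (nugatory) L5965–5975); §3.17
`\subsection{more adjustments}` L5981–6040 ((winter) L5986–5997, (solstice) L5998–6007, (swannee) L6010–6015, the
collections L6017–6032 with (naval), (representation9) L6033–6040); §3.18 `\subsection{final localization}` L6045–6446
(LEMMA 3.22 L6054–6070 with (lulu), LEMMA 3.23 L6278–6291 with (citrus)∕(lulu2), the Remark L6294–6295, the Conclusion
(almonds) L6413–6433, (representation10) L6436–6446).  J. Dimock, *The renormalization group according to Balaban I.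
Small fields*, Rev. Math. Phys. **25** (2013) 1330010 (= arXiv:1108.1335v2) [Dimock2013]: §1.2 (three0) L205–208
(*"⟨u,v⟩ = ∫u(x)v(x)dx ≡ L^{−3N}Σ_x u(x)v(x)"*) and (lattice1) L212–214, §1.3 L283 (*"This scaling preserves the
Laplacian term"*), §2.1 L318–320 (*"(Qf)(y) = L^{−3}Σ_{x∈B(y)} f(x)"*) and L411 (*"Q is scale invariant: Qφ_L = (Qφ)_L"*), §2.3 LEMMA 5 (scaling) L797–848 (*"We scale by f_L(x) = L^{−1/2}f(x/L)"* L814; (Ziterate) L805–807),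
§4.1 (recursive) L1932–1939, §4.7 L2547–2555.  J. Dimock, *… III. Convergence*, Ann. Henri Poincaré **15** (2014) 2133–2175
(= arXiv:1304.0705v1) [Dimock2013BalabanIII]: §3.2 L1563–1575 (*"The right side is scale invariant"*).  TeX line numbers
refer to the arXiv sources held by the cell (`inputs/files/dimock/src/1212.5562/1212.5562.tex`, sha256[:16]
75c5792fc48eacbc; `…/1108.1335/1108.1335.tex`, 7382e6540dded9be; `…/1304.0705/1304.0705.tex`, dfd556282834aeba; arXiv
subsection and `[section]`-counter numbering as in the cell's TEMPLATE.md CHANGES v2 (b)); every quotation below was read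
there this session.  Dimock's papers are published and refereed and are the cell's TEMPLATE, not manuscripts under
audit; no quantity of the Bałaban series is touched.

**What the paper prints (verbatim).**  §3.15, L5663–5667: *"We scale and evaluate ρ_{k+1}(Φ_{k+1}) = ρ̃(Φ_{k+1,L})
L^{−|𝕋¹_{M+N−k}|/2} … We make the following changes in this expression. This follows the discussion in section freeflow."*
— among the bullets: L5672 *"Identify Z_{k+1} = Z⁰_{k+1}L^{−|𝕋¹_{M+N−k}|/2}"*; L5674–5678 *"The sum over regions 𝛀⁺ … is
relabeled as L𝛀⁺ …"*; L5711–5719 *"the action S^{*,0}_{k+1}(Λ_k, Φ_{k+1,𝛀⁺}, φ⁰_{k+1,𝛀′}) becomes S^{*,0}_{k+1}(LΛ_k,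
Φ_{k+1,𝛀⁺,L}, φ_{k+1,𝛀′,L}) = S^*_{k+1}(Λ_k, Φ_{k+1,𝛀⁺}, φ_{k+1,𝛀′})  We split this as S^*_{k+1}(Λ_k) = S^*_{k+1}(Λ_k −
Λ_{k+1}) + S^*_{k+1}(Λ_{k+1})"*; L5722–5727 *"In E^+_k(Λ_k) = E_k(Λ_k) − V_k(Λ_k) we have the potential V_k(Λ_k,
φ⁰_{k+1,𝛀′}). This becomes V_k(LΛ_k, φ_{k+1,𝛀′,L}) = V^u_{k+1}(Λ_k, φ_{k+1,𝛀′}) and we split this as V^u_{k+1}(Λ_k) =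
V^u_{k+1}(Λ_k − Λ_{k+1}) + V^u_{k+1}(Λ_{k+1})"*; L5780–5789 *"Finally consider K_{k,𝚷} which scales to [K_{k,L^{−1}}]_𝚷 ≡
Π_{j=0}^k exp(c_j|Ω_j^{c,(j−1)}| − S^{+,u}_{j,L^{−(k+1−j)}}(Λ_{j−1} − Λ_j) + (B̃_{j,L^{−(k+1−j)}})_{𝚷_j}(Λ_{j−1}, Λ_j))"*;
L5790–5791 *"Collect all the scaled “B̃_{k+1,𝚷⁺} terms” into a single term B̃_{k+1,𝚷⁺}(Λ_k, Λ_{k+1})"*; then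
(representation8) L5800–5811: *"ρ_{k+1}(Φ_{k+1}) = Z_{k+1} Σ_{𝚷⁺} ∫ dΦ_{𝛀^{+,c}} dW_{𝚷⁺} [K_{k,L^{−1}}]_𝚷 𝒞_{k+1,𝚷⁺}
exp(c_{k+1}|Ω^{c,(k)}_{k+1}| − S^*_{k+1}(Λ_k − Λ_{k+1}) − V^u_{k+1}(Λ_k − Λ_{k+1}) + B̃_{k+1,𝚷⁺}(Λ_k, Λ_{k+1}))
χ_{k+1}(Λ_{k+1}) exp(−S^*_{k+1}(Λ_{k+1}) − ε⁰_kL³Vol(Λ_{k+1}) − V^u_{k+1}(Λ_{k+1}) + (ℬE_k)_{L^{−1}}(Λ_k) +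
(E^#_k)_{L^{−1}}(Λ_{k+1}) + [(R^#_k)_{L^{−1}}]_{𝚷⁺}(Λ_{k+1}) + [(B^#_k)_{L^{−1}}]_{𝚷⁺}(Λ_{k+1}))"*.  §3.16, L5818–5820:
*"Now we show that the coupling constant flow follows the global analysis of part I, even though the effective action is
localized. To do this we need to process the terms (ℬE_k)_{L^{−1}}(Λ_{k+1}) and (E^#_k)_{L^{−1}}(Λ_{k+1})"*; (poof)
L5925–5934: *"In the exponential in (representation8) we pick out the terms −ε⁰_kL³Vol(Λ) − V^u_{k+1}(Λ) +
(ℬE_k)_{L^{−1}}(Λ) + (E^#_k)_{L^{−1}}(Λ) = −(ε⁰_k + ε_k)L³Vol(Λ) − ½L²μ_k‖φ‖²_Λ − ¼Lλ_k∫_Λφ⁴ + (ℬE_k)_{L^{−1}}(Λ) +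
(E^#_k)_{L^{−1}}(Λ)  evaluated at Λ = Λ_{k+1} and φ = φ_{k+1,𝛀′}"*; L5935–5955: *"Applying (renorm5) to the last two terms
we have (ℬE_k)_{L^{−1}}(Λ) = … ≡ −𝓛₁(E_k)Vol(Λ) − ½𝓛₂(E_k)‖φ‖²_Λ + Σ_{X⊂Λ}(𝓛₃E_k)(X) + Σ_{X#Λ}(𝒯_Λ(ℬE_k)_{L^{−1}})(X)"*,
*"(E^#_k)_{L^{−1}}(Λ) = … ≡ −(ε^*_k − L³ε⁰_k)Vol(Λ) − ½μ^*_k‖φ‖²_Λ + Σ_{X⊂Λ}E^*_k(X) + Σ_{X#Λ}(𝒯_Λ(E^#_k)_{L^{−1}})(X)"*;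
L5956–5964: *"Insert these into (poof) and identify the coupling constants at the next level. As in part I these are:
ε_{k+1} = L³ε_k + 𝓛₁E_k + ε^*_k(λ_k, μ_k, E_k),  μ_{k+1} = L²μ_k + 𝓛₂E_k + μ^*_k(λ_k, μ_k, E_k),  λ_{k+1} = Lλ_k,  E_{k+1} =
𝓛₃E_k + E^*_k(λ_k, μ_k, E_k)"*; (nugatory) L5965–5975: *"Now the terms (poof) can be written: −ε_{k+1}Vol(Λ) −
½μ_{k+1}‖φ‖²_Λ − ¼λ_{k+1}∫_Λφ⁴ + Σ_{X⊂Λ}E_{k+1}(X) + Σ_{X#Λ}(𝒯_Λ(ℬE_k + E^#_k)_{L^{−1}})(X) = −V_{k+1}(Λ) + E_{k+1}(Λ) +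
(𝒯_Λ(ℬE_k + E^#_k)_{L^{−1}})(Λ)  still at Λ = Λ_{k+1} and φ = φ_{k+1,𝛀′}. We insert this back into (representation8)."*
§3.17, L5986–5997 (winter): *"In the active terms we change this to the desired φ_{k+1,𝛀(Λ*_{k+1})} defining tiny terms
R^{*,(i)}_{k+1,𝚷⁺} by S^*_{k+1}(Λ_{k+1}, Φ_{k+1}, φ_{k+1,𝛀′}) = S^*_{k+1}(Λ_{k+1}, Φ_{k+1}, φ_{k+1,𝛀(Λ*_{k+1})}) +
R^{*,(1)}_{k+1,𝚷⁺},  V_{k+1}(Λ_{k+1}, φ_{k+1,𝛀′}) = V_{k+1}(Λ_{k+1}, φ_{k+1,𝛀(Λ*_{k+1})}) + R^{*,(2)}_{k+1,𝚷⁺},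
E_{k+1}(Λ_{k+1}, φ_{k+1,𝛀′}) = E_{k+1}(Λ_{k+1}, φ_{k+1,𝛀(Λ*_{k+1})}) + R^{*,(3)}_{k+1,𝚷⁺}"*; (solstice) L5998–6007 (the same
for `S^*_{k+1}(δΛ_k, …)`, `V^u_{k+1}(δΛ_k, …)` with the field `φ_{k+1,𝛀(Λ_k,Ω_{k+1},Λ_{k+1})}` and `R^{*,(4)}`, `R^{*,(5)}`;
*"where δΛ_k = Λ_k − Λ_{k+1}"*); L6008–6015: *"With the new arguments we identify S^+_{k+1}(Λ_{k+1}) = S^*_{k+1}(Λ_{k+1})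
+ V_{k+1}(Λ_{k+1}), and S^{+,u}_{k+1}(δΛ_k) = S^*_{k+1}(δΛ_k) + V^u_{k+1}(δΛ_k), and then K_{k+1,𝚷⁺} = [K_{k,L^{−1}}]_𝚷
exp(c_{k+1}|Ω^{c,(k)}_{k+1}| − S^{+,u}_{k+1}(δΛ_k) + B̃_{k+1,𝚷⁺}(Λ_k, Λ_{k+1}))"* (swannee); L6017–6032: *"Now collect the
tiny terms defining R^{*,(0)}_{k+1,𝚷⁺} = [(R^#_k)_{L^{−1}}]_{𝚷⁺}(Λ_{k+1}) and R^*_{k+1,𝚷⁺} = R^{*,(0)}_{k+1,𝚷⁺} + … +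
R^{*,(5)}_{k+1,𝚷⁺}  For boundary terms there is B^{*,(0)}_{k+1,𝚷⁺} = [(B^#_k)_{L^{−1}}]_{𝚷⁺}(Λ_{k+1}). There is also the
part of (ℬE_k)_{L^{−1}}(Λ_k) left over after we took out (ℬE_k)_{L^{−1}}(Λ_{k+1}). This is B^{*,(1)}_{k+1,𝚷⁺} ≡
Σ_{X⊂Λ_k, X∩Λ^c_{k+1}≠∅} (ℬE_k)_{L^{−1}}(X, φ_{k+1,𝛀′})  Finally there is B^{*,(2)}_{k+1,𝚷⁺} = (𝒯_{Λ_{k+1}}(ℬE_k +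
E^#_k)_{L^{−1}})(Λ_{k+1}). Altogether then we define B^*_{k+1,𝚷⁺} = B^{*,(0)}_{k+1,𝚷⁺} + … + B^{*,(2)}_{k+1,𝚷⁺}"* (naval);
(representation9) L6033–6040: *"… K_{k+1,𝚷⁺} 𝒞_{k+1,𝚷⁺} χ_{k+1}(Λ_{k+1}) exp(−S^+_{k+1}(Λ_{k+1}) + E_{k+1}(Λ_{k+1}) +
R^*_{k+1,𝚷⁺} + B^*_{k+1,𝚷⁺})"*.  §3.18, LEMMA 3.22 L6055–6061: *"R^*_{k+1,𝚷⁺} = Σ_{X⊂Λ_{k+1}} R_{k+1,𝚷⁺}(X) +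
Σ_{X∈𝒟_{k+1}(mod Ω^c_{k+1}), X#Λ_{k+1}} B^{*,(R)}_{k+1,𝚷⁺}(X)"* with (lulu) L6064–6069; LEMMA 3.23 L6279–6282:
*"B^*_{k+1,𝚷⁺} = Σ_{X∈𝒟_{k+1}(mod Ω^c_{k+1}), X#Λ_{k+1}} (B^*_{k+1,𝚷⁺})′(X) + B̃_{k+1,𝚷⁺} terms"* with (lulu2) L6288–6290;
the Remark L6294–6295: *"The B̃_{k+1,𝚷⁺} terms are absorbed into the B̃_{k+1,𝚷⁺}(Λ_k, Λ_{k+1}) in (swannee)"*; the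
Conclusion L6413–6433: *"From the last two lemmas we can write R^*_{k+1,𝚷⁺} + B^*_{k+1,𝚷⁺} = R_{k+1,𝚷⁺}(Λ_{k+1}) +
B_{k+1,𝚷⁺}(Λ_{k+1}) (almonds) where B_{k+1,𝚷⁺}(X) = B^{*,(R)}_{k+1,𝚷⁺}(X) + (B^*_{k+1,𝚷⁺})′(X)  Then B_{k+1,𝚷⁺}(X) …
satisfies there |B_{k+1,𝚷⁺}(X)| ≤ (𝒪(1)λ_{k+1}^{n₀} + ½B₀λ_{k+1}^β)e^{−κd_M(X, mod Ω^c_{k+1})} ≤ B₀λ_{k+1}^βe^{−κd_M(X, mod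
Ω^c_{k+1})}  Also note that B̃_{k+1,𝚷⁺}(Λ_k, Λ_{k+1}) is analytic on (citrus) and satisfies for B₀ sufficiently large
|B̃_{k+1,𝚷⁺}(Λ_k, Λ_{k+1})| ≤ B₀|Λ^{(k+1)}_k − Λ^{(k+1)}_{k+1}|"*; (representation10) L6436–6446: *"Finally substituting
(almonds) into (representation9) yields ρ_{k+1}(Φ_{k+1}) = Z_{k+1} Σ_{𝚷⁺} ∫ … K_{k+1,𝚷⁺} 𝒞_{k+1,𝚷⁺} χ_{k+1}(Λ_{k+1})
exp(−S^+_{k+1}(Λ_{k+1}) + E_{k+1}(Λ_{k+1}) + R_{k+1,𝚷⁺}(Λ_{k+1}) + B_{k+1,𝚷⁺}(Λ_{k+1}))  All properties of the various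
functions have been established, so this completes the induction and the proof of the main theorem."*  THEOREM 3.1:
item 1 L2394–2397 *"Z_k is the global normalization factor of part I. It satisfies Z₀ = 1 and Z_{k+1} = Z_k
𝒩^{−1}_{a,𝕋¹_{M+N−k}} (2π)^{|𝕋⁰_{M+N−k}|/2}(det C_k)^{1/2}"*; (orca)'s third line L2362–2364 *"K_{k,𝚷} = Π_{j=0}^k
exp(c_j|Ω_j^{c,(j−1)}| − S^{+,u}_{j,L^{−(k−j)}}(Λ_{j−1} − Λ_j) + (B̃_{j,L^{−(k−j)}})_{𝚷_j}(Λ_{j−1}, Λ_j))"*; item 4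
L2447–2453 *"S^+_k(Λ_k, Φ_k, φ) = S^*_k(Λ_k, Φ_k, φ) + V_k(Λ_k, φ) …  V_k(Λ_k, φ) = ε_kVol(Λ_k) + ½μ_k‖φ²‖_{Λ_k} +
¼λ_k∫_{Λ_k}φ⁴"*; item 8 L2501–2506 *"The inactive boundary term has the form B̃_{k,𝚷}(Λ_{k−1}, Λ_k, Φ_{k,𝛀_k}, W_{k,𝚷}).
… satisfies there |B̃_{k,𝚷}(Λ_{k−1}, Λ_k)| ≤ B₀|Λ^{(k)}_{k−1} − Λ^{(k)}_k|  It is additive in the connected components of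
Λ_k^c"*; item 9 L2518–2526 *"With δΛ_{k−1} = Λ_{k−1} − Λ_k, the unrenormalized action is S^{+,u}_k(δΛ_{k−1}, …) where …
S^{+,u}_k(δΛ_{k−1}, Φ_{k,𝛀}, φ) = S^*_k(δΛ_{k−1}, Φ_{k,𝛀}, φ) + V^u_k(δΛ_{k−1}, φ)  V^u_k(Λ, φ) = L³ε_{k−1}Vol(Λ) +
½L²μ_{k−1}‖φ²‖_Λ + ¼λ_k∫_Λφ⁴"*; Remark 2 L2554–2570 *"The statement that the coupling constants ε_k, λ_k, μ_k in V_k are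
chosen as in part I means that they satisfy discrete dynamical equations (recursive) … The unrenormalized potential
V^u_j differs from the renormalized potential V_j only in that the last corrections to the coupling constants are not
included. That is we have energy density L³ε_{k−1} instead of ε_k = L³ε_{k−1} + … and mass L²μ_{k−1} instead of μ_k =
L²μ_{k−1} + ⋯"*.  (sugar) L3280–3287: *"Normalization factors are rearranged as (2π)^{½|Ω^{(k)}_{k+1}|} =
(2π)^{½|𝕋⁰_{M+N−k}|}(2π)^{−½|Ω^{c,(k)}_{k+1}|}  The first term contributes to Z⁰_{k+1} ≡ 𝒩^{−1}_{aL,𝕋¹_{M+N−k}}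
(2π)^{½|𝕋⁰_{M+N−k}|}(det C_k)^{1/2}Z_k"*.  §3.13 Remark 1 L4489–4491: *"The expression “B̃_{k+1,𝚷⁺} terms” will be used
repeatedly. It refers to functions localized in Λ^c_{k+1} which are bounded by C|Λ^{(k)}_k − Λ^{(k)}_{k+1}| = C Vol(Λ_k −
Λ_{k+1}). Local structure is no longer important for these terms."*  Part III §3.2 L1571–1575: *"By (someday) we have
|B̃_{N,𝚷}(Λ_{N−1}, Λ_N)| ≤ B₀|Λ^{(N)}_{N−1} − Λ^{(N)}_N|. The right side is scale invariant, so the scaled characteristic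
functions imply that |(B̃_{j,L^{−(N−j)}})_{𝚷_j}(Λ_{j−1}, Λ_j)| ≤ B₀|Λ^{(j)}_{j−1} − Λ^{(j)}_j|"*.  Part I: L814 *"We scale by
f_L(x) = L^{−1/2}f(x/L)"*; L283 *"This scaling preserves the Laplacian term"*; L2552–2555 *"V_k(φ_{k+1,L}) = L³ε_k
Vol(𝕋_{M+N−k−1}) + ½L²μ_k‖φ_{k+1}‖² + ¼Lλ_k∫φ⁴_{k+1}"*; (Ziterate) L805–807 (= item 1's recursion).

**Why this file (cell TEMPLATE.md §4.2 rows «D2 §3.15–3.16», «D2 §3.17–3.18», «D2 Thm maintheorem»).**  The lineage's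
kernel covers §3.16's localized extraction (`LocalizedExtraction`, (renorm2)–(renorm5)), §3.18's `B₀`- and tiny-term
arithmetic (`BoundaryTermLedger`, `TinyTermLedger`) and part I's assembly (stanley8) = (stanley9) with the recursion
(recursive) as DEFINITIONS (`SmallFieldStepAssembly`).  What closes the induction of THEOREM 3.1 — §3.15's scaling
relabellings, §3.16's identification *"As in part I these are"*, §3.17's regroupings and §3.18's Conclusion — was indexed
(TEMPLATE.md v8.105, row «D2 Thm maintheorem», items 1∕8∕9 *"not typed"*) but not kernel-checked.  This module types that
bookkeeping; in particular the printed sentence *"the coupling constant flow follows the global analysis of part I, even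
though the effective action is localized"* becomes an identity whose next-level couplings ARE `SmallFieldStepAssembly.
epsNext ∕ muNext ∕ lamNext ∕ ENext` (part I's (recursive), imported, not re-declared), and the three scaling rules that
`SmallFieldStepAssembly.V_scaled` took as hypotheses are PROVED as reindexings of weighted lattice sums.

**What is reproduced here (kernel-checked, zero `sorry`; imports the three lineage modules above, hence Mathlib).**
* Part 1 — SCALING AS REINDEXING (§3.15; part I L814, (three0)).  Two site types `S₁` (the lattice 𝕋^{−(k+1)} where the
  new fields live) and `S₀` (the lattice 𝕋^{−k}), the relabelling `σ : S₁ ≃ S₀` (print: `y ↦ Ly`), spacings `η₀ = Lη₁`,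
  the scaled field `scaleField c σ φ` (print `φ_L(x) = L^{−1/2}φ(x/L)`, `c = L^{−1/2}` i.e. `c²L = 1`; `scaleConst`,
  `scaleConst_sq_mul`), the weighted sums `vol`∕`nsq`∕`quart`∕`gradsq` (print `Vol(X)`, `‖φ‖²_X`, `∫_Xφ⁴`, `‖∂φ‖²` as
  `η³Σ_x`); PROVED: **`vol_scale`** (`Vol(LX) = L³Vol(X)`), **`nsq_scale`** (`‖φ_L‖²_{LX} = L²‖φ‖²_X`), **`quart_scale`**
  (`∫_{LX}φ_L⁴ = L∫_Xφ⁴`), `latDeriv_scale` + **`gradsq_scale`** (`‖∂φ_L‖²_{LX} = ‖∂φ‖²_X` — *"This scaling preserves the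
  Laplacian term"*, for forward differences intertwined by `σ`), `mass_scale` (`½μ̄_k‖φ_L‖² = ½μ̄_{k+1}‖φ‖²` for `μ̄_k =
  L^{−2}μ̄_{k+1}`), **`potential_scale`** (L5722–5727 ∕ part I L2552–2555: `V_k(LΛ, φ_L) = V^u_{k+1}(Λ, φ)`, obtained by
  feeding the three proved rules to `SmallFieldStepAssembly.V_scaled`), `card_scale_invariant` (part III L1572 *"The
  right side is scale invariant"*: `|LX| = |X|` as a count of sites).
* Part 2 — THE POTENTIALS (items 4, 9; Remark 2).  `Vu` = `V^u_{k+1}` as part I's `potential` at the unrenormalized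
  couplings `(L³ε_k, L²μ_k, λ_{k+1})`; `Vu_eq`; **`potential_sub_Vu`** (*"V^u differs from V only in that the last
  corrections to the coupling constants are not included"*: `V_{k+1} − V^u_{k+1} = (ε_{k+1} − L³ε_k)Vol + ½(μ_{k+1} −
  L²μ_k)‖φ‖²`) and **`potential_next_sub_Vu`** (with (recursive): the corrections ARE `𝓛₁E_k + ε^*_k` and `𝓛₂E_k + μ^*_k`);
  `addV_split` and **`potential_split`** (L5719 ∕ L5727: `F(Λ_k) = F(Λ_k − Λ_{k+1}) + F(Λ_{k+1})` for cube-additive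
  functionals and for the potential).
* Part 3 — THE FLOW IDENTIFICATION (§3.16 (poof) → (nugatory)).  Over an abstract field space `Φ` with `V = Vol(Λ_{k+1})`,
  `nsq φ = ‖φ‖²_{Λ_{k+1}}`, `quart φ = ∫_{Λ_{k+1}}φ⁴`: the two localized functionals `FB = (ℬE_k)_{L^{−1}}(Λ_{k+1}, ·)` and
  `FS = (E^#_k)_{L^{−1}}(Λ_{k+1}, ·)` are each *an extracted functional of part I plus a boundary functional* (`FB = XB.F +
  TB`, `FS = XS.F + TS` with `XB XS : SmallFieldStepAssembly.Extracted V nsq` — the shape (renorm2) — and `TB`, `TS` the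
  `Σ_{X#Λ}𝒯_Λ(·)(X)` of L5941∕L5951, whose production is `LocalizedExtraction.localized_extraction_of_const`); then
  **`poof_eq_exponent8`** (the picked-out terms (poof) EQUAL part I's (stanley8)-exponent `SmallFieldStepAssembly.
  exponent8` plus `TB + TS`) and **`nugatory`**: (poof) `= −S − V_{k+1}(Λ) + E_{k+1}(Λ) + (TB + TS)` where `V_{k+1}` is the
  potential at **`epsNext L ε_k ε⁰_k XB XS`, `muNext L μ_k XB XS`, `lamNext L λ_k`** and `E_{k+1} = ENext XB XS` — part I's
  DEFINITIONS (recursive) by name (`recursive_by_name` displays them); `extractedOfParts` ∕ `renorm5_shape` record how a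
  (renorm5)-output (global parts `g₀Vol + g₂‖φ‖² + ν∫φ∂φ` with `ν = 0` by lattice symmetry, remainder, boundary sum) is
  such a pair.
* Part 4 — §3.17 AS ONE REGROUPING.  `tinyDiff` ((winter)∕(solstice): `R^{*,(i)} := F(φ′) − F(φ″)`, `eq_add_tinyDiff`);
  **`sum_powerset_split`** ∕ `sum_family_split` (B^{*,(1)}, L6023–6027: for `Λ_{k+1} ⊆ Λ_k`, `Σ_{X⊂Λ_k} = Σ_{X⊂Λ_{k+1}} +
  Σ_{X⊂Λ_k, X∩Λ^c_{k+1}≠∅}`); `Kprod` ((orca): `K_k = Π_{j=0}^k exp t_j`), `Kprod_succ`, `Kprod_eq_exp_sum`, `Kprod_pos`,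
  **`swannee`** (`[K_k]·exp(new level) = K_{k+1}`); `Zseq` (item 1: `Z₀ = 1`, `Z_{k+1} = Z_k z_k`), **`Zseq_eq_prod`**;
  **`sugar`** (`(2π)^{|Ω|/2} = (2π)^{|𝕋|/2}(2π)^{−|Ω^c|/2}`); and **`representation9_exponent`** ∕ `representation9_factors`:
  the exponents of (representation8) — inactive `c − S^*(δΛ_k, φ′) − V^u(δΛ_k, φ′) + B̃` and active `−S^*(Λ_{k+1}, φ′) −
  ε⁰L³Vol − V^u(Λ_{k+1}, φ′) + (ℬE_k)_{L^{−1}}(Λ_k) + (E^#)_{L^{−1}}(Λ_{k+1}) + R^{*,(0)} + B^{*,(0)}` — EQUAL the exponents of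
  (swannee) + (representation9) — `c − S^{+,u}(δΛ_k, φ″) + B̃` and `−S^+_{k+1}(Λ_{k+1}, φ⋆) + E_{k+1}(Λ_{k+1}, φ⋆) + R^* +
  B^*` — with `R^* = R^{*,(0)} + … + R^{*,(5)}`, `B^* = B^{*,(0)} + B^{*,(1)} + B^{*,(2)}` (naval), given the B^{*,(1)} split
  and (nugatory); as reals and as products of exponentials.
* Part 5 — §3.18 CONCLUSION.  **`almonds`** (from the two lemma decompositions: `R^* + B^* = Σ_{X⊂Λ}R(X) + Σ_{X#Λ}(B^{*,(R)}
  + (B^*)′)(X) + B̃′`), **`B_next_bound`** (L6427–6428 for one polymer, the smallness `𝒪(1)λ^{n₀−β} ≤ ½B₀` explicit, via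
  `BoundaryTermLedger.conclusion_step` at `θ = ½`), `absorb_tilde` (the Remark L6294–6295: `exp(K-exponent)·exp(active +
  B̃′) = exp(K-exponent + B̃′)·exp(active)`), `representation10_exponent`.
* Part 6 — ITEM 8.  **`abs_sum_le_of_termwise`** (Remark 1 + L6430–6432: finitely many B̃ terms, each `|b_i| ≤ C_i·Vol(Λ_k −
  Λ_{k+1})`, and `Σ_iC_i ≤ B₀` give `|B̃| ≤ B₀Vol(Λ_k − Λ_{k+1})` — *"for B₀ sufficiently large"* made explicit) and
  **`sum_eq_sum_components`** (*"It is additive in the connected components of Λ_k^c"*: a sum of terms each localized in a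
  nonempty polymer inside one member of a pairwise-disjoint family regroups as a sum over the members).
* Part 7 — non-vacuity examples.
* Part 8 (v1.1) — §3.15's POLYMER-SUM RELABELLINGS (L5731–5778; part I §3.4 L1389–1393 *"define the scaled down
  F_{L^{−1}}(X, φ) = F(LX, φ_L)"*): `scaledDown` (`F_{L^{−1}}`), **`pow_scale`**∕`pow_scale_even` (the general monomial
  `∫_{LX}φ_Lⁿ = L³cⁿ∫_Xφⁿ`, `L^m∫_{LX}φ_L^{2m} = L³∫_Xφ^{2m}` — relevant `L³, L², L¹`, marginal `L⁰`), `map_subset_map_iff`,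
  **`crosses_map_iff`** (`LX # LΛ ⟺ X # Λ`), **`polymer_sum_scale`** (*"L𝒟_{k+1} = 𝒟⁰_{k+1}"* L5738 ∕ *"L𝒟_{k+1}(mod Ω^c_{k+1})
  = 𝒟⁰_{k+1}(mod LΩ^c_{k+1})"* L5778 as a reindexing of selected polymer sums along `X ↦ LX`, the selection predicate
  transported), **`sum_inside_scale`** (L5739–5745: `E_k(LΛ_k, φ_L) = Σ_{X∈𝒟_{k+1}, X⊂Λ_k}(ℬE_k)_{L^{−1}}(X, φ)`; likewise
  `E^#_k`, `R^#_k`), **`sum_crossing_scale`** (L5762–5777 for `B^#_k` over the crossing polymers modulo holes).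
* Part 9 (v1.2) — §3.18's `B^{*,(2)} = 𝒯_{Λ_{k+1}}E^*_k` ESTIMATE ASSEMBLED (L6365–6407): `coeff_mul_field_le` (one relevant
  part × one restricted field functional), **`Bstar2_bound`** (from the three coefficient bounds L6392–6396 and the field
  bounds L6398–6399 as hypotheses, *"since 2δ < ε"*: `|B^{*,(2)}(X)| ≤ (c + 4cc′)L³λ^βe^{−2κd_M(X)}` = L6400–6401 with its
  `𝒪(1)` explicit), `Bstar2_quarter` (the `¼B₀` form via `BoundaryTermLedger.new_term_fraction`, *"𝒪(1)L³ ≤ ¼B₀"* L6344).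
* Part 10 (v1.3) — «Q IS SCALE INVARIANT» AND «S^{*,0}_{k+1} SCALES TO S^*_{k+1}» (§3.15 L5711–5717; §2.3 (oooo) L939–943 and
  L920–922; part I (71) L831–841, L411, L814): `scaleField_sub`, `blockAvg` (`(Qφ)(y) = w·Σ_{x∈B(y)}φ(x)`), **`blockAvg_scale`**
  (`Qφ_L = (Qφ)_L` for blocks transported by the relabellings), `Qterm_nsq_scale`, **`Qterm_scale`** (`(a/L²)‖Φ_L − Qφ_L‖²_{LX′} = a‖Φ −
  Qφ‖²_{X′}`), **`Sstar0_scale`** (the four-term action of LEMMA 2.5 L1069–1075, every field on its own lattice: the scaled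
  action equals `(a_{k+1}/2)‖Φ_{k+1} − Q_{k+1}φ‖² + (a_kL²/2)‖Φ_k − Q_kφ‖² + ½‖∂φ‖² + ½μ̄_{k+1}‖φ‖²` — reading (i)'s `Q`-term now
  typed); v1.4: `S0_scale` (part I LEMMA 5 eq. (71), the three-term case) and a locator DOCFIX (part I section numbers §1.2∕§1.3∕§2.1).

**Readings ∕ divergences (declared).**  (i) SCALING: lattices are abstract finite site types related by an equivalence
`σ` (print: `𝕋^{−(k+1)}_{M+N−k−1} → 𝕋^{−k}_{M+N−k}`, `y ↦ Ly`); integrals are `η³`-weighted site sums ((three0)); the forward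
difference (lattice1) uses abstract successor maps `τ₁`, `τ₀` intertwined by `σ` (print: `L(y + η₁e_μ) = Ly + η₀e_μ`); the
constant `c` is any real with `c²L = 1` (print `L^{−1/2}`; `scaleConst`); the `Q`-term `½a‖Φ − Qφ‖²` of `S^*` is typed in
Part 10 (v1.3) with the block average abstract (`blockAvg`, blocks transported by the relabellings); the `*`-restricted
norms are arbitrary finite sets of bonds ∕ sites (`gradsq_scale`, `nsq`).  (ii) PART 3 works at the fixed region `Λ = Λ_{k+1}` and pointwise in the field; `V`, `nsq`, `quart`
are the abstract slots of `SmallFieldStepAssembly` (there: the whole torus; here: `Λ_{k+1}`) — the print's *"As in part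
I"*; the boundary functionals `TB`, `TS` carry whatever sign the extraction produces (`LocalizedExtraction`'s reading
(iii) records a sign-slip candidate in (renorm5); immaterial here and downstream).  (iii) PART 4 is an identity of real
numbers (see the SIGN BOOKKEEPING note at `representation9_exponent`: the (winter)∕(solstice) differences of the functionals
carrying a minus sign in the exponent are collected with `−`) at three fixed field configurations `φ′ = φ_{k+1,𝛀′}`, `φ⋆ = φ_{k+1,𝛀(Λ*_{k+1})}`, `φ″ = φ_{k+1,𝛀(Λ_k,Ω_{k+1},
Λ_{k+1})}`; the scaled objects `[K_{k,L^{−1}}]_𝚷`, `[(R^#_k)_{L^{−1}}]_{𝚷⁺}`, … are VALUES (the relabelling of their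
arguments is Part 1's reindexing, not re-derived term by term).  (iv) ITEM 8's components: *"connected components"* enter
as an abstract pairwise-disjoint family containing every (nonempty) localization polymer — connectedness itself is not
used by the regrouping.  (v) Constants: `𝒪(1)` of L6427 is a named real `c₁`; `B₀ ≥ Σ_iC_i` is the explicit form of *"for
B₀ sufficiently large"* (L6430).

**What is NOT claimed.**  The analytic content of §§3.15–3.18 — the bounds (lulu), (lulu2), (sluggish), (noisette), the
decoupling expansions, analyticity domains (citrus), the random-walk estimates, LEMMA 3.22∕3.23 themselves — enters only
as hypothesis shapes or not at all; the measures `dΦ`, `dW`, the characteristic functions, the sum over `𝚷⁺` and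
(representation8)–(representation10) as identities of DENSITIES are not typed (exponents and finite products only); the
block structure of `Q` beyond abstract transported blocks (reading (i)); the reblocking `ℬ` itself (`Reblocking`, LEMMA citizen, by name) and the
coarse polymer families as anything but images of the fine ones along `X ↦ LX` (Part 8); (estar) L6367–6375 and the
derivation of the coefficient∕field bounds of Part 9 (part I LEMMA study-type estimates), the localization of `B^{*,(2)}`; the identification `Z_{k+1} = Z⁰_{k+1}L^{−|𝕋¹|/2}` (a definition); nothing
of B1–B16 (TEMPLATE.md rows «D2 §3.15–3.16» ↔ B14 §3 ∕ B12 (0.18)–(0.20), «D2 §3.17–3.18» ↔ B14 §3 end ∕ B16 §1, «D2 Thm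
maintheorem» ↔ B14 §2 — grades P∕T∕«T (format) ∕ N (R-operation part)» unchanged; in d = 4 the coupling flow itself
(B12 Thm 2) remains the unproved leaf).  NOT summit progress; NOT a statement about any Bałaban paper; NOT continuum;
NOT Clay.  NEW leaf; imports `SmallFieldStepAssembly` (gen 32), `LocalizedExtraction` (gen 35), `BoundaryTermLedger`
(gen 22) only; sub-namespace `…Dimock2011to13.LocalizedStepAssembly`; modifies nothing; no named fact.  Unit
`b2b-balaban-template` gen 42 (journal CLAIM D2-STEP-ASSEMBLY-KERNEL); cell records TEMPLATE.md §4.2 rows «D2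
§3.15–3.16», «D2 §3.17–3.18», «D2 Thm maintheorem», §15.2; GAPS C-tmpl42-1.
-/

noncomputable section

open Real Finset
open scoped BigOperators

namespace Literature.MathematicalPhysics.QuantumFieldTheory.Dimock2011to13.LocalizedStepAssembly

open SmallFieldStepAssembly (Extracted potential lamNext epsNext muNext ENext L1E L2E L3E epsStar muStar EStar
  exponent8 exponent9 stanley9_of_stanley8 V_scaled)
open LocalizedExtraction (addV)

/-! ## Part 1 — Scaling as reindexing (§3.15; part I L814 `f_L(x) = L^{−1/2}f(x/L)`, (three0) `∫ = L^{−3N}Σ_x`) -/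

section Scaling

variable {S₀ S₁ : Type*}

/-- **The scaled field** `φ_L(x) = L^{−1/2}φ(x/L)` (part I L814): on the coarse sites `S₀` (print `𝕋^{−k}`), from a field on
the fine sites `S₁` (print `𝕋^{−(k+1)}`), through the relabelling `σ : S₁ ≃ S₀` (print `y ↦ Ly`), with the constant `c`
(print `L^{−1/2}`). [cite: Dimock2013, Lemma 5 (scaling) proof (arXiv:1108.1335v2 TeX L814); Dimock2013BalabanII, §3.15
(arXiv:1212.5562v2 TeX L5682–5708)] -/
def scaleField (c : ℝ) (σ : S₁ ≃ S₀) (φ : S₁ → ℝ) : S₀ → ℝ := fun x => c * φ (σ.symm x)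

/-- `φ_L(Ly) = L^{−1/2}φ(y)`. [cite: Dimock2013, Lemma 5 (scaling) proof (arXiv:1108.1335v2 TeX L814)] -/
@[simp] theorem scaleField_apply (c : ℝ) (σ : S₁ ≃ S₀) (φ : S₁ → ℝ) (y : S₁) :
    scaleField c σ φ (σ y) = c * φ y := by
  simp [scaleField]

/-- The scaling constant `L^{−1/2}`, written `(√L)⁻¹`. [cite: Dimock2013, Lemma 5 (scaling) proof (arXiv:1108.1335v2 TeX L814)] -/
def scaleConst (L : ℝ) : ℝ := (Real.sqrt L)⁻¹

/-- `(L^{−1/2})²·L = 1` for `L > 0` — the only property of the scaling constant of *"We scale by f_L(x) = L^{−1/2}f(x/L)"*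
used below. [cite: Dimock2013, Lemma 5 (scaling) proof (arXiv:1108.1335v2 TeX L814)] -/
theorem scaleConst_sq_mul {L : ℝ} (hL : 0 < L) : scaleConst L ^ 2 * L = 1 := by
  unfold scaleConst
  rw [inv_pow, Real.sq_sqrt hL.le, inv_mul_cancel₀ hL.ne']

/-- **`Vol(X) = ∫_X 1 = η³·|X|`** on a lattice of spacing `η` ((three0): `∫ ≡ L^{−3N}Σ_x`). [cite: Dimock2013, §1.2 eq.
(three0) (arXiv:1108.1335v2 TeX L205–208)] -/
def vol {S : Type*} (η : ℝ) (X : Finset S) : ℝ := η ^ 3 * (X.card : ℝ)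

/-- **`‖φ‖²_X = ∫_X φ² = η³Σ_{x∈X} φ(x)²`**. [cite: Dimock2013, §1.2 eq. (three0) (arXiv:1108.1335v2 TeX L205–208)] -/
def nsq {S : Type*} (η : ℝ) (X : Finset S) (φ : S → ℝ) : ℝ := ∑ x ∈ X, η ^ 3 * φ x ^ 2

/-- **`∫_X φ⁴ = η³Σ_{x∈X} φ(x)⁴`**. [cite: Dimock2013, §1.2 eq. (three0) (arXiv:1108.1335v2 TeX L205–208)] -/
def quart {S : Type*} (η : ℝ) (X : Finset S) (φ : S → ℝ) : ℝ := ∑ x ∈ X, η ^ 3 * φ x ^ 4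

/-- **The forward lattice derivative** `(∂_μφ)(x) = (φ(x + ηe_μ) − φ(x))/η` ((lattice1)), with the successor map
`τ = (· + ηe_μ)` abstract. [cite: Dimock2013, §1.2 eq. (lattice1) (arXiv:1108.1335v2 TeX L212–214)] -/
def latDeriv {S : Type*} (τ : S → S) (η : ℝ) (φ : S → ℝ) : S → ℝ := fun x => (φ (τ x) - φ x) / η

/-- **`‖∂_μφ‖²_B = η³Σ_{x∈B} (∂_μφ)(x)²`** over a finite set of bonds (their base points) `B`. [cite: Dimock2013, §1.2 eqs.
(three0), (lattice1) (arXiv:1108.1335v2 TeX L205–214)] -/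
def gradsq {S : Type*} (τ : S → S) (η : ℝ) (B : Finset S) (φ : S → ℝ) : ℝ :=
  ∑ x ∈ B, η ^ 3 * latDeriv τ η φ x ^ 2

/-- **`Vol(LX) = L³·Vol(X)`** (*"ε⁰_kVol(𝕋_{M+N−k}) = L³ε⁰_kVol(𝕋_{M+N−k−1})"*, part I L2549; here for any region, `LX =
σ(X)`, `η₀ = Lη₁`). [cite: Dimock2013, §4.7 (arXiv:1108.1335v2 TeX L2547–2555); Dimock2013BalabanII, §3.15
(arXiv:1212.5562v2 TeX L5722–5727)] -/
theorem vol_scale {L η₀ η₁ : ℝ} (hη : η₀ = L * η₁) (σ : S₁ ≃ S₀) (X : Finset S₁) :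
    vol η₀ (X.map σ.toEmbedding) = L ^ 3 * vol η₁ X := by
  unfold vol
  rw [Finset.card_map, hη]
  ring

/-- **`‖φ_L‖²_{LX} = L²‖φ‖²_X`** (part I L2552–2555, the mass term): reindex along `σ` and use `c²L = 1`.
[cite: Dimock2013, §4.7 (arXiv:1108.1335v2 TeX L2547–2555); Dimock2013BalabanII, §3.15 (arXiv:1212.5562v2 TeX L5722–5727)] -/
theorem nsq_scale {L η₀ η₁ c : ℝ} (hη : η₀ = L * η₁) (hc : c ^ 2 * L = 1) (σ : S₁ ≃ S₀) (X : Finset S₁)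
    (φ : S₁ → ℝ) :
    nsq η₀ (X.map σ.toEmbedding) (scaleField c σ φ) = L ^ 2 * nsq η₁ X φ := by
  unfold nsq
  rw [Finset.sum_map, Finset.mul_sum]
  refine Finset.sum_congr rfl fun y _ => ?_
  rw [Equiv.coe_toEmbedding, scaleField_apply, hη]
  linear_combination (L ^ 2 * η₁ ^ 3 * φ y ^ 2) * hc

/-- **`∫_{LX} φ_L⁴ = L∫_X φ⁴`** (part I L2552–2555, the quartic term; `¼Lλ_k = ¼λ_{k+1}`): reindex along `σ` and use
`(c²L)² = 1`. [cite: Dimock2013, §4.7 (arXiv:1108.1335v2 TeX L2547–2555); Dimock2013BalabanII, §3.15 (arXiv:1212.5562v2 TeX L5722–5727)] -/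
theorem quart_scale {L η₀ η₁ c : ℝ} (hη : η₀ = L * η₁) (hc : c ^ 2 * L = 1) (σ : S₁ ≃ S₀) (X : Finset S₁)
    (φ : S₁ → ℝ) :
    quart η₀ (X.map σ.toEmbedding) (scaleField c σ φ) = L * quart η₁ X φ := by
  unfold quart
  rw [Finset.sum_map, Finset.mul_sum]
  refine Finset.sum_congr rfl fun y _ => ?_
  rw [Equiv.coe_toEmbedding, scaleField_apply, hη]
  linear_combination (L * η₁ ^ 3 * φ y ^ 4 * (c ^ 2 * L + 1)) * hc

/-- The derivative of the scaled field: `L·(∂φ_L)(Ly) = L^{−1/2}·(∂φ)(y)` when the successor maps are intertwined by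
the relabelling (`σ(y + η₁e) = σ(y) + η₀e`) and `η₀ = Lη₁`, `L ≠ 0` (part I L817–820: scaling produces `L^{−2}` on
second-order operators). [cite: Dimock2013, Lemma 5 (scaling) proof (arXiv:1108.1335v2 TeX L814–828)] -/
theorem latDeriv_scale {L η₀ η₁ c : ℝ} (hη : η₀ = L * η₁) (hL : L ≠ 0) (σ : S₁ ≃ S₀) (τ₀ : S₀ → S₀)
    (τ₁ : S₁ → S₁) (hτ : ∀ y, σ (τ₁ y) = τ₀ (σ y)) (φ : S₁ → ℝ) (y : S₁) :
    L * latDeriv τ₀ η₀ (scaleField c σ φ) (σ y) = c * latDeriv τ₁ η₁ φ y := by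
  simp only [latDeriv, ← hτ, scaleField_apply, hη, ← mul_sub]
  rw [← mul_div_assoc, mul_div_mul_left _ _ hL, mul_div_assoc]

/-- **`‖∂φ_L‖²_{LB} = ‖∂φ‖²_B`** — *"This scaling preserves the Laplacian term"* (part I L283; L834–841 `½‖∂φ_{k+1,L}‖² =
½‖∂φ_{k+1}‖²`), for any finite set of bonds `B`, successor maps intertwined by `σ`, `η₀ = Lη₁`, `c²L = 1`, `L ≠ 0`.
[cite: Dimock2013, §1.3 (arXiv:1108.1335v2 TeX L283) and Lemma 5 (scaling) (TeX L831–841); Dimock2013BalabanII, §3.15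
(arXiv:1212.5562v2 TeX L5711–5717)] -/
theorem gradsq_scale {L η₀ η₁ c : ℝ} (hη : η₀ = L * η₁) (hc : c ^ 2 * L = 1) (hL : L ≠ 0) (σ : S₁ ≃ S₀)
    (τ₀ : S₀ → S₀) (τ₁ : S₁ → S₁) (hτ : ∀ y, σ (τ₁ y) = τ₀ (σ y)) (B : Finset S₁) (φ : S₁ → ℝ) :
    gradsq τ₀ η₀ (B.map σ.toEmbedding) (scaleField c σ φ) = gradsq τ₁ η₁ B φ := by
  unfold gradsq
  rw [Finset.sum_map]
  refine Finset.sum_congr rfl fun y _ => ?_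
  rw [Equiv.coe_toEmbedding]
  have hLX := latDeriv_scale (c := c) hη hL σ τ₀ τ₁ hτ φ y
  set X := latDeriv τ₀ η₀ (scaleField c σ φ) (σ y)
  set D := latDeriv τ₁ η₁ φ y
  rw [hη]
  calc (L * η₁) ^ 3 * X ^ 2 = L * η₁ ^ 3 * (L * X) ^ 2 := by ring
    _ = L * η₁ ^ 3 * (c * D) ^ 2 := by rw [hLX]
    _ = η₁ ^ 3 * D ^ 2 := by linear_combination (η₁ ^ 3 * D ^ 2) * hc

/-- **The mass term**: `½μ̄_k‖φ_L‖²_{LX} = ½μ̄_{k+1}‖φ‖²_X` for `μ̄_k = L^{−2}μ̄_{k+1}` (part I L815 *"μ̄_k = L^{−2}μ̄_{k+1}"*,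
L836–839). [cite: Dimock2013, Lemma 5 (scaling) (arXiv:1108.1335v2 TeX L814–841)] -/
theorem mass_scale {L η₀ η₁ c mubar mubar1 : ℝ} (hη : η₀ = L * η₁) (hc : c ^ 2 * L = 1)
    (hmu : mubar * L ^ 2 = mubar1) (σ : S₁ ≃ S₀) (X : Finset S₁) (φ : S₁ → ℝ) :
    (1 / 2) * mubar * nsq η₀ (X.map σ.toEmbedding) (scaleField c σ φ) = (1 / 2) * mubar1 * nsq η₁ X φ := by
  rw [nsq_scale hη hc, ← hmu]
  ring

/-- **`V_k(LΛ, φ_L) = V^u_{k+1}(Λ, φ)`** — §3.15 L5722–5727 (*"This becomes V_k(LΛ_k, φ_{k+1,𝛀′,L}) = V^u_{k+1}(Λ_k,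
φ_{k+1,𝛀′})"*) ∕ part I L2552–2555: the three scaling rules, PROVED above, fed to part I's `SmallFieldStepAssembly.V_scaled`
(where they were hypotheses). [cite: Dimock2013BalabanII, §3.15 (arXiv:1212.5562v2 TeX L5722–5727); Dimock2013, §4.7
(arXiv:1108.1335v2 TeX L2551–2555)] -/
theorem potential_scale {L η₀ η₁ c : ℝ} (hη : η₀ = L * η₁) (hc : c ^ 2 * L = 1) (σ : S₁ ≃ S₀) (Λ : Finset S₁)
    (φ : S₁ → ℝ) (epsk muk lamk : ℝ) :
    potential epsk muk lamk (vol η₀ (Λ.map σ.toEmbedding)) (nsq η₀ (Λ.map σ.toEmbedding) (scaleField c σ φ))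
        (quart η₀ (Λ.map σ.toEmbedding) (scaleField c σ φ))
      = L ^ 3 * epsk * vol η₁ Λ + (1 / 2) * (L ^ 2 * muk) * nsq η₁ Λ φ
          + (1 / 4) * lamNext L lamk * quart η₁ Λ φ :=
  V_scaled (vol_scale hη σ Λ) (nsq_scale hη hc σ Λ φ) (quart_scale hη hc σ Λ φ)

/-- *"The right side is scale invariant"* (part III L1572, about `B₀|Λ^{(j)}_{j−1} − Λ^{(j)}_j|`): a COUNT of lattice
points is unchanged by the relabelling. [cite: Dimock2013BalabanIII, §3.2 (arXiv:1304.0705v1 TeX L1571–1575)] -/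
theorem card_scale_invariant (σ : S₁ ↪ S₀) (X : Finset S₁) : (X.map σ).card = X.card :=
  Finset.card_map σ

end Scaling

/-! ## Part 2 — The potentials `V_k`, `V^u_{k+1}` (items 4, 9; Remark 2) and the splits `F(Λ_k) = F(δΛ_k) + F(Λ_{k+1})` -/

section Potentials

/-- **`V^u_{k+1}(Λ, φ) = L³ε_kVol(Λ) + ½L²μ_k‖φ²‖_Λ + ¼λ_{k+1}∫_Λφ⁴`** (item 9, L2525–2526, shifted `k ↦ k+1`): part I's
`potential` at the UNRENORMALIZED couplings. [cite: Dimock2013BalabanII, Theorem 3.1 item 9 (arXiv:1212.5562v2 TeX L2518–2528)] -/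
def Vu (L epsk muk lamk V n q : ℝ) : ℝ := potential (L ^ 3 * epsk) (L ^ 2 * muk) (lamNext L lamk) V n q

/-- `V^u_{k+1}` unfolded. [cite: Dimock2013BalabanII, Theorem 3.1 item 9 (arXiv:1212.5562v2 TeX L2525–2526)] -/
theorem Vu_eq (L epsk muk lamk V n q : ℝ) :
    Vu L epsk muk lamk V n q
      = L ^ 3 * epsk * V + (1 / 2) * (L ^ 2 * muk) * n + (1 / 4) * lamNext L lamk * q :=
  rfl

/-- §3.15's potential bullet restated with `Vu`: `V_k(LΛ, φ_L) = V^u_{k+1}(Λ, φ)`. [cite: Dimock2013BalabanII, §3.15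
(arXiv:1212.5562v2 TeX L5722–5727)] -/
theorem potential_scale_eq_Vu {S₀ S₁ : Type*} {L η₀ η₁ c : ℝ} (hη : η₀ = L * η₁) (hc : c ^ 2 * L = 1)
    (σ : S₁ ≃ S₀) (Λ : Finset S₁) (φ : S₁ → ℝ) (epsk muk lamk : ℝ) :
    potential epsk muk lamk (vol η₀ (Λ.map σ.toEmbedding)) (nsq η₀ (Λ.map σ.toEmbedding) (scaleField c σ φ))
        (quart η₀ (Λ.map σ.toEmbedding) (scaleField c σ φ))
      = Vu L epsk muk lamk (vol η₁ Λ) (nsq η₁ Λ φ) (quart η₁ Λ φ) := by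
  rw [potential_scale hη hc, Vu_eq]

/-- **Remark 2** (L2568–2570): *"The unrenormalized potential V^u_j differs from the renormalized potential V_j only in
that the last corrections to the coupling constants are not included. That is we have energy density L³ε_{k−1} instead of
ε_k = L³ε_{k−1} + … and mass L²μ_{k−1} instead of μ_k = L²μ_{k−1} + ⋯"*: for any next-level couplings `(ε′, μ′, λ_{k+1})`,
`V − V^u = (ε′ − L³ε_k)Vol + ½(μ′ − L²μ_k)‖φ‖²`. [cite: Dimock2013BalabanII, Theorem 3.1 Remark 2 (arXiv:1212.5562v2 TeX L2568–2570)] -/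
theorem potential_sub_Vu (L epsk muk lamk eps' mu' V n q : ℝ) :
    potential eps' mu' (lamNext L lamk) V n q - Vu L epsk muk lamk V n q
      = (eps' - L ^ 3 * epsk) * V + (1 / 2) * (mu' - L ^ 2 * muk) * n := by
  simp only [Vu, potential]
  ring

/-- Remark 2 WITH (recursive): at `ε_{k+1} = epsNext`, `μ_{k+1} = muNext` the *"last corrections"* ARE `𝓛₁E_k + ε^*_k`
and `𝓛₂E_k + μ^*_k` of part I. [cite: Dimock2013BalabanII, Theorem 3.1 Remark 2 eq. (recursive) (arXiv:1212.5562v2 TeX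
L2553–2570); Dimock2013, Theorem lanky eq. (recursive) (arXiv:1108.1335v2 TeX L1932–1939)] -/
theorem potential_next_sub_Vu {Φ : Type*} {V : ℝ} {nsq : Φ → ℝ} (L epsk eps0 muk lamk : ℝ)
    (XB XS : Extracted V nsq) (φ : Φ) (q : ℝ) :
    potential (epsNext L epsk eps0 XB XS) (muNext L muk XB XS) (lamNext L lamk) V (nsq φ) q
        - Vu L epsk muk lamk V (nsq φ) q
      = (L1E XB + epsStar L eps0 XS) * V + (1 / 2) * (L2E XB + muStar XS) * nsq φ := by
  rw [potential_sub_Vu]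
  simp only [epsNext, muNext]
  ring

variable {C : Type*} [DecidableEq C]

/-- **`F(Λ_k) = F(Λ_k − Λ_{k+1}) + F(Λ_{k+1})`** for a cube-additive functional and `Λ_{k+1} ⊆ Λ_k` — L5719 *"We split
this as S^*_{k+1}(Λ_k) = S^*_{k+1}(Λ_k − Λ_{k+1}) + S^*_{k+1}(Λ_{k+1})"*, L5727 for `V^u_{k+1}`. [cite: Dimock2013BalabanII,
§3.15 (arXiv:1212.5562v2 TeX L5718–5727)] -/
theorem addV_split (v : C → ℝ) {Λ Λ' : Finset C} (h : Λ' ⊆ Λ) :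
    addV v Λ = addV v (Λ \ Λ') + addV v Λ' := by
  unfold addV
  exact (Finset.sum_sdiff h).symm

/-- **`V(Λ_k) = V(Λ_k − Λ_{k+1}) + V(Λ_{k+1})`** for the potential built from cube functionals `Vol(□)`, `‖φ‖²_□`, `∫_□φ⁴`
(L5727, *"we split this as V^u_{k+1}(Λ_k) = V^u_{k+1}(Λ_k − Λ_{k+1}) + V^u_{k+1}(Λ_{k+1})"*). [cite: Dimock2013BalabanII,
§3.15 (arXiv:1212.5562v2 TeX L5722–5727)] -/
theorem potential_split (e m l : ℝ) (vc nc qc : C → ℝ) {Λ Λ' : Finset C} (h : Λ' ⊆ Λ) :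
    potential e m l (addV vc Λ) (addV nc Λ) (addV qc Λ)
      = potential e m l (addV vc (Λ \ Λ')) (addV nc (Λ \ Λ')) (addV qc (Λ \ Λ'))
          + potential e m l (addV vc Λ') (addV nc Λ') (addV qc Λ') := by
  simp only [potential, addV_split vc h, addV_split nc h, addV_split qc h]
  ring

end Potentials

/-! ## Part 3 — The flow identification: (poof) → (nugatory) with part I's (recursive) BY NAME (§3.16 L5925–5975) -/

section Flow

variable {Φ : Type*}

/-- **(poof), first line** (L5926–5929): the terms picked out of the exponent of (representation8) on `Λ = Λ_{k+1}`, with the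
action value `S = S^*_{k+1}(Λ_{k+1})` carried along — `−S − ε⁰_kL³Vol(Λ) − V^u_{k+1}(Λ) + (ℬE_k)_{L^{−1}}(Λ) +
(E^#_k)_{L^{−1}}(Λ)` (`FB`, `FS` the last two functionals; `V = Vol(Λ)`, `nsq φ = ‖φ‖²_Λ`, `quart φ = ∫_Λφ⁴`).
[cite: Dimock2013BalabanII, §3.16 eq. (poof) (arXiv:1212.5562v2 TeX L5925–5934)] -/
def poof (V : ℝ) (nsq : Φ → ℝ) (S L epsk eps0 muk lamk : ℝ) (quart FB FS : Φ → ℝ) (φ : Φ) : ℝ :=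
  -S - eps0 * L ^ 3 * V - Vu L epsk muk lamk V (nsq φ) (quart φ) + FB φ + FS φ

variable {V : ℝ} {nsq : Φ → ℝ}

/-- **(poof), second line = part I's (stanley8)-exponent plus the boundary functionals**: if `(ℬE_k)_{L^{−1}}(Λ, ·)` and
`(E^#_k)_{L^{−1}}(Λ, ·)` are each an extracted functional of shape (renorm2) plus their `Σ_{X#Λ}𝒯_Λ(·)(X)` (L5935–5955:
*"Applying (renorm5) to the last two terms"*), then the picked-out terms equal `SmallFieldStepAssembly.exponent8` (at `V =
Vol(Λ_{k+1})`) plus `TB + TS`. [cite: Dimock2013BalabanII, §3.16 eqs. (poof) and L5935–5955 (arXiv:1212.5562v2 TeX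
L5925–5955); Dimock2013, §4.7 eq. (stanley8) (arXiv:1108.1335v2 TeX L2588–2597)] -/
theorem poof_eq_exponent8 (S L epsk eps0 muk lamk : ℝ) (quart FB FS TB TS : Φ → ℝ) (XB XS : Extracted V nsq)
    (hB : ∀ φ, FB φ = XB.F φ + TB φ) (hS : ∀ φ, FS φ = XS.F φ + TS φ) (φ : Φ) :
    poof V nsq S L epsk eps0 muk lamk quart FB FS φ
      = exponent8 S L epsk eps0 muk lamk quart XB XS φ + (TB φ + TS φ) := by
  simp only [poof, Vu, potential, exponent8, hB φ, hS φ]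
  ring

/-- **(nugatory) — THE COUPLING CONSTANTS AT THE NEXT LEVEL ARE PART I's** (L5956–5975: *"Insert these into (poof) and
identify the coupling constants at the next level. As in part I these are: ε_{k+1} = L³ε_k + 𝓛₁E_k + ε^*_k, μ_{k+1} =
L²μ_k + 𝓛₂E_k + μ^*_k, λ_{k+1} = Lλ_k, E_{k+1} = 𝓛₃E_k + E^*_k … Now the terms (poof) can be written: … = −V_{k+1}(Λ) +
E_{k+1}(Λ) + (𝒯_Λ(ℬE_k + E^#_k)_{L^{−1}})(Λ)"*): with `ε_{k+1} := SmallFieldStepAssembly.epsNext`, `μ_{k+1} := muNext`,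
`λ_{k+1} := lamNext`, `E_{k+1} := ENext` — the DEFINITIONS (recursive) of part I's kernel, not re-declared — the picked-out
terms equal `−S − V_{k+1}(Λ, φ) + E_{k+1}(Λ, φ) + (TB + TS)(φ)`; the proof is part I's `stanley9_of_stanley8`.
[cite: Dimock2013BalabanII, §3.16 L5956–5975 eq. (nugatory) (arXiv:1212.5562v2 TeX L5956–5975); Dimock2013, Theorem
lanky eq. (recursive) (arXiv:1108.1335v2 TeX L1932–1939)] -/
theorem nugatory (S L epsk eps0 muk lamk : ℝ) (quart FB FS TB TS : Φ → ℝ) (XB XS : Extracted V nsq)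
    (hB : ∀ φ, FB φ = XB.F φ + TB φ) (hS : ∀ φ, FS φ = XS.F φ + TS φ) (φ : Φ) :
    poof V nsq S L epsk eps0 muk lamk quart FB FS φ
      = -S - potential (epsNext L epsk eps0 XB XS) (muNext L muk XB XS) (lamNext L lamk) V (nsq φ) (quart φ)
          + ENext XB XS φ + (TB φ + TS φ) := by
  rw [poof_eq_exponent8 S L epsk eps0 muk lamk quart FB FS TB TS XB XS hB hS φ, stanley9_of_stanley8]
  simp only [exponent9, potential]
  ring

/-- (nugatory) with the identifications of L6008 — `S^+_{k+1}(Λ_{k+1}) = S^*_{k+1}(Λ_{k+1}) + V_{k+1}(Λ_{k+1})` — displayed: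
the picked-out terms are `−S^+_{k+1} + E_{k+1} + B^{*,(2)}` with `B^{*,(2)} := (𝒯_Λ(ℬE_k + E^#_k)_{L^{−1}})(Λ) = TB + TS`
(L6028–6029). [cite: Dimock2013BalabanII, §3.16 eq. (nugatory) and §3.17 L6008, L6028–6029 (arXiv:1212.5562v2 TeX
L5965–5975, L6008–6029)] -/
theorem nugatory_Splus (S L epsk eps0 muk lamk : ℝ) (quart FB FS TB TS : Φ → ℝ) (XB XS : Extracted V nsq)
    (hB : ∀ φ, FB φ = XB.F φ + TB φ) (hS : ∀ φ, FS φ = XS.F φ + TS φ) (φ : Φ) :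
    poof V nsq S L epsk eps0 muk lamk quart FB FS φ
      = -(S + potential (epsNext L epsk eps0 XB XS) (muNext L muk XB XS) (lamNext L lamk) V (nsq φ) (quart φ))
          + ENext XB XS φ + (TB φ + TS φ) := by
  rw [nugatory S L epsk eps0 muk lamk quart FB FS TB TS XB XS hB hS φ]
  ring

/-- The recursion used, DISPLAYED (it is part I's, by name): `ε_{k+1} = L³ε_k + 𝓛₁E_k + ε^*_k`, `μ_{k+1} = L²μ_k + 𝓛₂E_k +
μ^*_k`, `λ_{k+1} = Lλ_k`, `E_{k+1} = 𝓛₃E_k + E^*_k`. [cite: Dimock2013BalabanII, §3.16 L5957–5963 and Remark 2 eq.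
(recursive) (arXiv:1212.5562v2 TeX L5956–5964, L2556–2563); Dimock2013, Theorem lanky eq. (recursive) (arXiv:1108.1335v2 TeX L1932–1939)] -/
theorem recursive_by_name (L epsk eps0 muk lamk : ℝ) (XB XS : Extracted V nsq) (φ : Φ) :
    epsNext L epsk eps0 XB XS = L ^ 3 * epsk + L1E XB + epsStar L eps0 XS
      ∧ muNext L muk XB XS = L ^ 2 * muk + L2E XB + muStar XS
      ∧ lamNext L lamk = L * lamk
      ∧ ENext XB XS φ = L3E XB φ + EStar XS φ :=
  ⟨rfl, rfl, rfl, rfl⟩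

/-- **A (renorm5)-output as an extracted functional** (junction with `LocalizedExtraction`): a functional on `Λ` written as
global relevant parts `g₀Vol(Λ) + g₂‖φ‖²_Λ` plus a remainder `Σ_{X⊂Λ}(𝓡E)(X)` (the marginal part `ν∫φ∂φ` having `ν = 0` —
*"the lattice symmetries imply that ν_μ(E) = 0"*, L5874) is the shape (renorm2) with `ε = −g₀`, `μ = −2g₂` (print: `g₀ =
−ε(E)`, `g₂ = −½μ(E)`, L5862–5873); the norm slots are free nonnegative reals. [cite: Dimock2013BalabanII, §3.16
L5859–5875, eq. (renorm5) (arXiv:1212.5562v2 TeX L5849–5921)] -/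
def extractedOfParts (V : ℝ) (nsq : Φ → ℝ) (g₀ g₂ : ℝ) (R : Φ → ℝ) (nF nR : ℝ) (hnF : 0 ≤ nF) :
    Extracted V nsq where
  F := fun φ => g₀ * V + g₂ * nsq φ + R φ
  nF := nF
  eps := -g₀
  mu := -2 * g₂
  R := R
  nR := nR
  nF_nonneg := hnF
  eq := fun φ => by ring

/-- The junction, stated: if `F(φ) = g₀Vol(Λ) + g₂‖φ‖²_Λ + ν·W(φ) + Σ_{X⊂Λ}𝓡E(X, φ) + T(φ)` (the shape delivered by
`LocalizedExtraction.localized_extraction_of_const` with the boundary sum `T`) and `ν = 0`, then `F = X.F + T` with `X =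
extractedOfParts …` — the hypothesis shape of `poof_eq_exponent8` ∕ `nugatory`. [cite: Dimock2013BalabanII, §3.16 eq.
(renorm5) and L5935–5955 (arXiv:1212.5562v2 TeX L5915–5955)] -/
theorem renorm5_shape (g₀ g₂ ν : ℝ) (W R T F : Φ → ℝ) (nF nR : ℝ) (hnF : 0 ≤ nF) (hν : ν = 0)
    (hF : ∀ φ, F φ = g₀ * V + g₂ * nsq φ + ν * W φ + R φ + T φ) (φ : Φ) :
    F φ = (extractedOfParts V nsq g₀ g₂ R nF nR hnF).F φ + T φ := by
  rw [hF φ, hν]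
  simp only [extractedOfParts]
  ring

end Flow

/-! ## Part 4 — §3.17 "more adjustments" as one regrouping; the sequences `K_{k,𝚷}` (orca)∕(swannee) and `Z_k` (item 1) -/

section Adjustments

variable {Φ : Type*}

/-- **The tiny terms of (winter)∕(solstice)**: `R^{*,(i)} := F(φ′) − F(φ″)` — the change of the field argument in one
functional (L5986–6007). [cite: Dimock2013BalabanII, §3.17 eqs. (winter), (solstice) (arXiv:1212.5562v2 TeX L5986–6007)] -/
def tinyDiff (F : Φ → ℝ) (φ₁ φ₂ : Φ) : ℝ := F φ₁ - F φ₂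

/-- (winter)∕(solstice) as printed: `F(φ′) = F(φ″) + R^{*,(i)}`. [cite: Dimock2013BalabanII, §3.17 eqs. (winter),
(solstice) (arXiv:1212.5562v2 TeX L5986–6007)] -/
theorem eq_add_tinyDiff (F : Φ → ℝ) (φ₁ φ₂ : Φ) : F φ₁ = F φ₂ + tinyDiff F φ₁ φ₂ := by
  unfold tinyDiff
  ring

variable {C : Type*} [DecidableEq C] {M : Type*} [AddCommMonoid M]

/-- **The B^{*,(1)} split** (L6022–6027: *"the part of (ℬE_k)_{L^{−1}}(Λ_k) left over after we took out
(ℬE_k)_{L^{−1}}(Λ_{k+1}). This is B^{*,(1)}_{k+1,𝚷⁺} ≡ Σ_{X⊂Λ_k, X∩Λ^c_{k+1}≠∅}(ℬE_k)_{L^{−1}}(X, …)"*): for `Λ_{k+1} ⊆ Λ_k`,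
`Σ_{X⊂Λ_k} f(X) = Σ_{X⊂Λ_{k+1}} f(X) + Σ_{X⊂Λ_k, X∖Λ_{k+1}≠∅} f(X)`. [cite: Dimock2013BalabanII, §3.17 (arXiv:1212.5562v2 TeX L6022–6027)] -/
theorem sum_powerset_split (f : Finset C → M) {Λ Λ' : Finset C} (h : Λ' ⊆ Λ) :
    ∑ X ∈ Λ.powerset, f X
      = ∑ X ∈ Λ'.powerset, f X + ∑ X ∈ Λ.powerset.filter (fun X => (X \ Λ').Nonempty), f X := by
  rw [← Finset.sum_filter_add_sum_filter_not Λ.powerset (fun X => X ⊆ Λ')]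
  congr 1
  · refine Finset.sum_congr ?_ fun _ _ => rfl
    ext X
    simp only [mem_filter, mem_powerset]
    exact ⟨fun hX => hX.2, fun hX => ⟨hX.trans h, hX⟩⟩
  · refine Finset.sum_congr ?_ fun _ _ => rfl
    ext X
    simp only [mem_filter, mem_powerset, Finset.sdiff_nonempty]

/-- The same split inside a polymer family `D` (print: `X ∈ 𝒟_{k+1}`): `Σ_{X∈D, X⊂Λ_k} = Σ_{X∈D, X⊂Λ_{k+1}} + Σ_{X∈D, X⊂Λ_k,
X∖Λ_{k+1}≠∅}`. [cite: Dimock2013BalabanII, §3.17 (arXiv:1212.5562v2 TeX L6022–6027)] -/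
theorem sum_family_split (D : Finset (Finset C)) (f : Finset C → M) {Λ Λ' : Finset C} (h : Λ' ⊆ Λ) :
    ∑ X ∈ D.filter (· ⊆ Λ), f X
      = ∑ X ∈ D.filter (· ⊆ Λ'), f X + ∑ X ∈ (D.filter (· ⊆ Λ)).filter (fun X => (X \ Λ').Nonempty), f X := by
  rw [← Finset.sum_filter_add_sum_filter_not (D.filter (· ⊆ Λ)) (fun X => X ⊆ Λ')]
  congr 1
  · refine Finset.sum_congr ?_ fun _ _ => rfl
    ext X
    simp only [mem_filter]
    exact ⟨fun hX => ⟨hX.1.1, hX.2⟩, fun hX => ⟨⟨hX.1, hX.2.trans h⟩, hX.2⟩⟩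
  · refine Finset.sum_congr ?_ fun _ _ => rfl
    ext X
    simp only [mem_filter, Finset.sdiff_nonempty]

/-- **(orca)'s history factor** `K_{k,𝚷} = Π_{j=0}^{k} exp(t_j)` with `t_j = c_j|Ω_j^{c,(j−1)}| − S^{+,u}_j(Λ_{j−1} − Λ_j) +
B̃_j(Λ_{j−1}, Λ_j)` (the level exponents as a real sequence). [cite: Dimock2013BalabanII, Theorem 3.1 eq. (orca)
(arXiv:1212.5562v2 TeX L2362–2364)] -/
def Kprod (t : ℕ → ℝ) (k : ℕ) : ℝ := ∏ j ∈ Finset.range (k + 1), Real.exp (t j)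

/-- `K_{k+1} = K_k · exp(t_{k+1})`. [cite: Dimock2013BalabanII, Theorem 3.1 eq. (orca) and §3.17 eq. (swannee)
(arXiv:1212.5562v2 TeX L2362–2364, L6010–6015)] -/
theorem Kprod_succ (t : ℕ → ℝ) (k : ℕ) : Kprod t (k + 1) = Kprod t k * Real.exp (t (k + 1)) := by
  unfold Kprod
  rw [Finset.prod_range_succ]

/-- `K_k = exp(Σ_{j=0}^k t_j)`. [cite: Dimock2013BalabanII, Theorem 3.1 eq. (orca) (arXiv:1212.5562v2 TeX L2362–2364)] -/
theorem Kprod_eq_exp_sum (t : ℕ → ℝ) (k : ℕ) :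
    Kprod t k = Real.exp (∑ j ∈ Finset.range (k + 1), t j) := by
  unfold Kprod
  rw [Real.exp_sum]

/-- `K_k > 0`. [cite: Dimock2013BalabanII, Theorem 3.1 eq. (orca) (arXiv:1212.5562v2 TeX L2362–2364)] -/
theorem Kprod_pos (t : ℕ → ℝ) (k : ℕ) : 0 < Kprod t k := by
  rw [Kprod_eq_exp_sum]
  exact Real.exp_pos _

/-- **(swannee)** (L6010–6015): `K_{k+1,𝚷⁺} = [K_{k,L^{−1}}]_𝚷 · exp(c_{k+1}|Ω^{c,(k)}_{k+1}| − S^{+,u}_{k+1}(δΛ_k) +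
B̃_{k+1,𝚷⁺}(Λ_k, Λ_{k+1}))` — the scaled old product (L5783–5788; a relabelling of the arguments of each factor, values
unchanged) times the new level's factor IS (orca)'s product at `k+1` once `t_{k+1}` is the new exponent.
[cite: Dimock2013BalabanII, §3.17 eq. (swannee) and §3.15 L5780–5789 (arXiv:1212.5562v2 TeX L6010–6015, L5780–5789)] -/
theorem swannee (t : ℕ → ℝ) (k : ℕ) (c SplusU Btil : ℝ) (ht : t (k + 1) = c - SplusU + Btil) :
    Kprod t k * Real.exp (c - SplusU + Btil) = Kprod t (k + 1) := by
  rw [Kprod_succ, ht]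

/-- **Item 1's normalization sequence**: `Z₀ = 1`, `Z_{k+1} = Z_k·z_k` with `z_k = 𝒩^{−1}_{a,𝕋¹_{M+N−k}}(2π)^{|𝕋⁰_{M+N−k}|/2}
(det C_k)^{1/2}` (the one-step factor is `GaussianSingleStep`'s (cloudy3), not re-derived). [cite: Dimock2013BalabanII,
Theorem 3.1 item 1 (arXiv:1212.5562v2 TeX L2393–2397); Dimock2013, Lemma 5 eq. (Ziterate) (arXiv:1108.1335v2 TeX L805–807)] -/
def Zseq (z : ℕ → ℝ) : ℕ → ℝ
  | 0 => 1
  | k + 1 => Zseq z k * z k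

/-- `Z₀ = 1`. [cite: Dimock2013BalabanII, Theorem 3.1 item 1 (arXiv:1212.5562v2 TeX L2394)] -/
@[simp] theorem Zseq_zero (z : ℕ → ℝ) : Zseq z 0 = 1 := rfl

/-- `Z_{k+1} = Z_k z_k`. [cite: Dimock2013BalabanII, Theorem 3.1 item 1 (arXiv:1212.5562v2 TeX L2395–2397)] -/
@[simp] theorem Zseq_succ (z : ℕ → ℝ) (k : ℕ) : Zseq z (k + 1) = Zseq z k * z k := rfl

/-- `Z_k = Π_{j<k} z_j` — the recursion solved. [cite: Dimock2013BalabanII, Theorem 3.1 item 1 (arXiv:1212.5562v2 TeX L2393–2397)] -/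
theorem Zseq_eq_prod (z : ℕ → ℝ) (k : ℕ) : Zseq z k = ∏ j ∈ Finset.range k, z j := by
  induction k with
  | zero => simp
  | succ k ih => rw [Zseq_succ, ih, Finset.prod_range_succ]

/-- **(sugar)** (L3280–3283): `(2π)^{½|Ω^{(k)}_{k+1}|} = (2π)^{½|𝕋⁰_{M+N−k}|}(2π)^{−½|Ω^{c,(k)}_{k+1}|}` — for a subset `Ω` of a
finite site type. [cite: Dimock2013BalabanII, §3.8 eq. (sugar) (arXiv:1212.5562v2 TeX L3280–3287)] -/
theorem sugar {T : Type*} [Fintype T] [DecidableEq T] (Ω : Finset T) :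
    (2 * π) ^ ((Ω.card : ℝ) / 2)
      = (2 * π) ^ ((Fintype.card T : ℝ) / 2) * (2 * π) ^ (-((Ωᶜ.card : ℝ) / 2)) := by
  rw [← Real.rpow_add (by positivity : (0 : ℝ) < 2 * π)]
  congr 1
  rw [Finset.card_compl, Nat.cast_sub (Finset.card_le_univ Ω)]
  ring

/-- **§3.17 AS ONE REGROUPING — the exponents of (representation8) equal those of (swannee) + (representation9).**
Inactive exponent of (representation8): `c − S^*(δΛ_k, φ′) − V^u(δΛ_k, φ′) + B̃`; active exponent: `−S^*(Λ_{k+1}, φ′) −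
ε⁰L³Vol(Λ_{k+1}) − V^u(Λ_{k+1}, φ′) + (ℬE_k)_{L^{−1}}(Λ_k, φ′) + (E^#_k)_{L^{−1}}(Λ_{k+1}, φ′) + R^{*,(0)} + B^{*,(0)}`
(`R^{*,(0)} = [(R^#_k)_{L^{−1}}]_{𝚷⁺}(Λ_{k+1})`, `B^{*,(0)} = [(B^#_k)_{L^{−1}}]_{𝚷⁺}(Λ_{k+1})`).  GIVEN the B^{*,(1)} split
`(ℬE_k)_{L^{−1}}(Λ_k, φ′) = (ℬE_k)_{L^{−1}}(Λ_{k+1}, φ′) + B^{*,(1)}` (`sum_powerset_split`) and (nugatory) on `Λ_{k+1}` at `φ′`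
(`nugatory`: `−ε⁰L³Vol − V^u + (ℬE_k)_{L^{−1}}(Λ_{k+1}) + (E^#)_{L^{−1}}(Λ_{k+1}) = −V_{k+1}(φ′) + E_{k+1}(φ′) + B^{*,(2)}`), the sum
of the two exponents EQUALS `(c − (S^*(δΛ_k, φ″) + V^u(δΛ_k, φ″)) + B̃)` — (swannee)'s, with `S^{+,u} = S^* + V^u` — plus
`(−(S^*(Λ_{k+1}, φ⋆) + V_{k+1}(Λ_{k+1}, φ⋆)) + E_{k+1}(Λ_{k+1}, φ⋆) + R^* + B^*)` — (representation9)'s, with `S^+ = S^* + V`,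
`R^*` collecting `R^{*,(0)}` and the five (winter)∕(solstice) differences, and `B^* = B^{*,(0)} + B^{*,(1)} + B^{*,(2)}`
(naval).  Fields: `φ′ = φ_{k+1,𝛀′}`, `φ⋆ = φ_{k+1,𝛀(Λ*_{k+1})}`, `φ″ = φ_{k+1,𝛀(Λ_k,Ω_{k+1},Λ_{k+1})}`.  **SIGN BOOKKEEPING
(INFO, records only):** with `R^{*,(i)}` defined by (winter)∕(solstice) exactly as printed (`F(φ′) = F(φ″) + R^{*,(i)}`), the
differences belonging to `S^*_{k+1}(Λ_{k+1})`, `V_{k+1}(Λ_{k+1})`, `S^*_{k+1}(δΛ_k)`, `V^u_{k+1}(δΛ_k)` — functionals that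
enter the exponent with a MINUS sign — enter the collected tiny term with `−` (`R^* = R^{*,(0)} − R^{*,(1)} − R^{*,(2)} +
R^{*,(3)} − R^{*,(4)} − R^{*,(5)}` below), where L6019–6020 prints `R^* = R^{*,(0)} + … + R^{*,(5)}`; the print's `+` absorbs
these signs into the `R^{*,(i)}`, immaterial downstream since LEMMA 3.22 bounds each piece in absolute value — a notational
point of the published template, not adjudicated.
[cite: Dimock2013BalabanII, §3.17 eqs. (winter)–(representation9) (arXiv:1212.5562v2 TeX L5981–6040)] -/
theorem representation9_exponent
    (Sstar Vnext Enext SstarOut VuOut FBout : Φ → ℝ) (φ' φs φ'' : Φ)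
    (c Btil eps0L3Vol R0 B0 B1 B2 : ℝ) (VuIn FBin FSin : Φ → ℝ)
    (hsplit : FBout φ' = FBin φ' + B1)
    (hnug : -eps0L3Vol - VuIn φ' + FBin φ' + FSin φ' = -Vnext φ' + Enext φ' + B2) :
    (c - SstarOut φ' - VuOut φ' + Btil)
        + (-Sstar φ' - eps0L3Vol - VuIn φ' + FBout φ' + FSin φ' + R0 + B0)
      = (c - (SstarOut φ'' + VuOut φ'') + Btil)
        + (-(Sstar φs + Vnext φs) + Enext φs
            + (R0 - tinyDiff Sstar φ' φs - tinyDiff Vnext φ' φs + tinyDiff Enext φ' φs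
                - tinyDiff SstarOut φ' φ'' - tinyDiff VuOut φ' φ'')
            + (B0 + B1 + B2)) := by
  simp only [tinyDiff]
  linear_combination hsplit + hnug

/-- The same regrouping for the two exponential FACTORS of (representation8) (the `K`-type factor and the active factor):
`exp(inactive₈)·exp(active₈) = exp((swannee)'s exponent)·exp((representation9)'s exponent)`. [cite: Dimock2013BalabanII,
§3.17 eqs. (swannee), (representation9) (arXiv:1212.5562v2 TeX L6010–6040)] -/
theorem exp_mul_exp_of_add_eq {A B A' B' : ℝ} (h : A + B = A' + B') :
    Real.exp A * Real.exp B = Real.exp A' * Real.exp B' := by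
  rw [← Real.exp_add, ← Real.exp_add, h]

/-- (representation8) → (representation9) for the factors, assembled from `representation9_exponent`.
[cite: Dimock2013BalabanII, §3.17 eqs. (winter)–(representation9) (arXiv:1212.5562v2 TeX L5981–6040)] -/
theorem representation9_factors
    (Sstar Vnext Enext SstarOut VuOut FBout : Φ → ℝ) (φ' φs φ'' : Φ)
    (c Btil eps0L3Vol R0 B0 B1 B2 : ℝ) (VuIn FBin FSin : Φ → ℝ)
    (hsplit : FBout φ' = FBin φ' + B1)
    (hnug : -eps0L3Vol - VuIn φ' + FBin φ' + FSin φ' = -Vnext φ' + Enext φ' + B2) :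
    Real.exp (c - SstarOut φ' - VuOut φ' + Btil)
        * Real.exp (-Sstar φ' - eps0L3Vol - VuIn φ' + FBout φ' + FSin φ' + R0 + B0)
      = Real.exp (c - (SstarOut φ'' + VuOut φ'') + Btil)
        * Real.exp (-(Sstar φs + Vnext φs) + Enext φs
            + (R0 - tinyDiff Sstar φ' φs - tinyDiff Vnext φ' φs + tinyDiff Enext φ' φs
                - tinyDiff SstarOut φ' φ'' - tinyDiff VuOut φ' φ'')
            + (B0 + B1 + B2)) :=
  exp_mul_exp_of_add_eq
    (representation9_exponent Sstar Vnext Enext SstarOut VuOut FBout φ' φs φ'' c Btil eps0L3Vol R0 B0 B1 B2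
      VuIn FBin FSin hsplit hnug)

end Adjustments

/-! ## Part 5 — §3.18 Conclusion: (almonds) → (representation10) -/

section Conclusion

variable {P : Type*}

/-- **(almonds)** (L6415–6423): from LEMMA 3.22's decomposition `R^* = Σ_{X⊂Λ_{k+1}}R(X) + Σ_{X#Λ_{k+1}}B^{*,(R)}(X)` and LEMMA
3.23's `B^* = Σ_{X#Λ_{k+1}}(B^*)′(X) + B̃′` one has `R^* + B^* = Σ_{X⊂Λ}R(X) + Σ_{X#Λ}(B^{*,(R)}(X) + (B^*)′(X)) + B̃′` —
*"R^* + B^* = R_{k+1}(Λ_{k+1}) + B_{k+1}(Λ_{k+1}) where B_{k+1}(X) = B^{*,(R)}(X) + (B^*)′(X)"* (and the B̃′ of the Remark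
L6294–6295). `PΛ`, `Pcross` = the index families (print: `X ⊂ Λ_{k+1}`; `X ∈ 𝒟_{k+1}(mod Ω^c_{k+1})`, `X # Λ_{k+1}`).
[cite: Dimock2013BalabanII, §3.18 Lemmas 3.22, 3.23 and eq. (almonds) (arXiv:1212.5562v2 TeX L6054–6061, L6278–6295, L6413–6423)] -/
theorem almonds (PΛ Pcross : Finset P) (R BR B' : P → ℝ) (Btil' Rstar Bstar : ℝ)
    (hR : Rstar = ∑ X ∈ PΛ, R X + ∑ X ∈ Pcross, BR X)
    (hB : Bstar = ∑ X ∈ Pcross, B' X + Btil') :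
    Rstar + Bstar = ∑ X ∈ PΛ, R X + ∑ X ∈ Pcross, (BR X + B' X) + Btil' := by
  rw [hR, hB, Finset.sum_add_distrib]
  ring

/-- **The bound of the Conclusion for one polymer** (L6424–6428): from (lulu) `|B^{*,(R)}(X)| ≤ 𝒪(1)λ^{n₀}e^{−κd}` and (lulu2)
`|(B^*)′(X)| ≤ ½B₀λ^βe^{−κd}`, *"|B_{k+1}(X)| ≤ (𝒪(1)λ^{n₀} + ½B₀λ^β)e^{−κd} ≤ B₀λ^βe^{−κd}"* — the last step for `𝒪(1)λ^{n₀−β}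
≤ ½B₀` (*"λ_k sufficiently small"*, explicit), by `BoundaryTermLedger.conclusion_step` at `θ = ½`.
[cite: Dimock2013BalabanII, §3.18 Conclusion (arXiv:1212.5562v2 TeX L6424–6429)] -/
theorem B_next_bound {c₁ B₀ β n₀ κ d lam bR b' : ℝ} (hlam : 0 < lam)
    (hR : |bR| ≤ c₁ * lam ^ n₀ * Real.exp (-κ * d))
    (hB : |b'| ≤ (1 / 2) * B₀ * lam ^ β * Real.exp (-κ * d))
    (hsmall : c₁ * lam ^ (n₀ - β) ≤ (1 - 1 / 2) * B₀) :
    |bR + b'| ≤ B₀ * lam ^ β * Real.exp (-κ * d) :=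
  calc |bR + b'| ≤ |bR| + |b'| := abs_add_le _ _
    _ ≤ c₁ * lam ^ n₀ * Real.exp (-κ * d) + (1 / 2) * B₀ * lam ^ β * Real.exp (-κ * d) := add_le_add hR hB
    _ = (c₁ * lam ^ n₀ + (1 / 2) * B₀ * lam ^ β) * Real.exp (-κ * d) := by ring
    _ ≤ B₀ * lam ^ β * Real.exp (-κ * d) := BoundaryTermLedger.conclusion_step hlam hsmall

/-- **The Remark L6294–6295**: *"The B̃ terms are absorbed into the B̃(Λ_k, Λ_{k+1}) in (swannee)"* — moving `B̃′` from the
active exponential into the `K`-factor's exponential. [cite: Dimock2013BalabanII, §3.18 Remark (arXiv:1212.5562v2 TeX L6294–6295)] -/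
theorem absorb_tilde (Kexp active Btil' : ℝ) :
    Real.exp Kexp * Real.exp (active + Btil') = Real.exp (Kexp + Btil') * Real.exp active :=
  exp_mul_exp_of_add_eq (by ring)

/-- **(representation9) → (representation10)** (L6436–6446): with (almonds), the active exponent `−S^+ + E + R^* + B^*`
equals `−S^+ + E + R_{k+1}(Λ_{k+1}) + B_{k+1}(Λ_{k+1}) + B̃′` — *"All properties of the various functions have been
established, so this completes the induction and the proof of the main theorem"* (the bookkeeping part).
[cite: Dimock2013BalabanII, §3.18 eqs. (almonds), (representation10) (arXiv:1212.5562v2 TeX L6413–6446)] -/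
theorem representation10_exponent (PΛ Pcross : Finset P) (R BR B' : P → ℝ) (Btil' Rstar Bstar Splus E : ℝ)
    (hR : Rstar = ∑ X ∈ PΛ, R X + ∑ X ∈ Pcross, BR X)
    (hB : Bstar = ∑ X ∈ Pcross, B' X + Btil') :
    -Splus + E + Rstar + Bstar
      = -Splus + E + (∑ X ∈ PΛ, R X) + (∑ X ∈ Pcross, (BR X + B' X)) + Btil' := by
  rw [add_assoc (-Splus + E), almonds PΛ Pcross R BR B' Btil' Rstar Bstar hR hB]
  ring

end Conclusion

/-! ## Part 6 — Item 8: the inactive boundary bound «for B₀ sufficiently large» and additivity over components -/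

section Inactive

/-- **Item 8's bound, assembled** (L2503–2505 ∕ L6430–6432 with Remark 1 L4489–4491): `B̃_{k+1}(Λ_k, Λ_{k+1})` is the
collection (L5790–5791) of finitely many *"B̃ terms"*, each *"bounded by C|Λ^{(k)}_k − Λ^{(k)}_{k+1}| = C Vol(Λ_k − Λ_{k+1})"*;
hence `|B̃| ≤ (Σ_iC_i)·Vol ≤ B₀·Vol` — *"for B₀ sufficiently large"* = `Σ_iC_i ≤ B₀`, explicit and `k`-free as long as the
list of terms and their constants is. [cite: Dimock2013BalabanII, Theorem 3.1 item 8 and §3.18 L6430–6432, §3.13 Remark 1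
(arXiv:1212.5562v2 TeX L2500–2506, L6430–6433, L4487–4491)] -/
theorem abs_sum_le_of_termwise {ι : Type*} (I : Finset ι) (b Cst : ι → ℝ) {v B₀ : ℝ} (hv : 0 ≤ v)
    (hb : ∀ i ∈ I, |b i| ≤ Cst i * v) (hB₀ : ∑ i ∈ I, Cst i ≤ B₀) :
    |∑ i ∈ I, b i| ≤ B₀ * v :=
  calc |∑ i ∈ I, b i| ≤ ∑ i ∈ I, |b i| := Finset.abs_sum_le_sum_abs _ _
    _ ≤ ∑ i ∈ I, Cst i * v := Finset.sum_le_sum hb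
    _ = (∑ i ∈ I, Cst i) * v := by rw [Finset.sum_mul]
    _ ≤ B₀ * v := mul_le_mul_of_nonneg_right hB₀ hv

variable {C : Type*} [DecidableEq C] {M : Type*} [AddCommMonoid M]

/-- **«It is additive in the connected components of Λ_k^c»** (L2506): a sum of terms each localized in a NONEMPTY polymer
`Z` lying inside one member of a pairwise-disjoint family `𝒞` (print: the connected components `Θ_γ` of `Λ^c_k`; every
B̃ term is *"localized in Λ^c_{k+1}"*, Remark 1, and a connected polymer lies in one component) regroups as the sum over
the members of the partial sums — `B̃ = Σ_γ B̃_γ`. [cite: Dimock2013BalabanII, Theorem 3.1 item 8 (arXiv:1212.5562v2 TeX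
L2500–2506) and §3.13 Remark 1 (TeX L4489–4491)] -/
theorem sum_eq_sum_components (Pz 𝒞 : Finset (Finset C)) (f : Finset C → M)
    (hdisj : ∀ Θ₁ ∈ 𝒞, ∀ Θ₂ ∈ 𝒞, Θ₁ ≠ Θ₂ → Disjoint Θ₁ Θ₂)
    (hP : ∀ Z ∈ Pz, Z.Nonempty ∧ ∃ Θ ∈ 𝒞, Z ⊆ Θ) :
    ∑ Z ∈ Pz, f Z = ∑ Θ ∈ 𝒞, ∑ Z ∈ Pz.filter (· ⊆ Θ), f Z := by
  classical
  have hfib : (𝒞 : Set (Finset C)).PairwiseDisjoint (fun Θ => Pz.filter (· ⊆ Θ)) := by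
    intro Θ₁ h₁ Θ₂ h₂ hne
    rw [Function.onFun, Finset.disjoint_left]
    intro Z hZ₁ hZ₂
    rw [mem_filter] at hZ₁ hZ₂
    obtain ⟨x, hx⟩ := (hP Z hZ₁.1).1
    exact Finset.disjoint_left.1 (hdisj Θ₁ h₁ Θ₂ h₂ hne) (hZ₁.2 hx) (hZ₂.2 hx)
  rw [← Finset.sum_biUnion hfib]
  refine Finset.sum_congr ?_ fun _ _ => rfl
  ext Z
  simp only [mem_biUnion, mem_filter]
  constructor
  · intro hZ
    obtain ⟨_, Θ, hΘ, hZΘ⟩ := hP Z hZ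
    exact ⟨Θ, hΘ, hZ, hZΘ⟩
  · rintro ⟨Θ, _, hZ, _⟩
    exact hZ

end Inactive

/-! ## Part 8 — §3.15's polymer-sum relabellings: `F_{L^{−1}}(X, φ) = F(LX, φ_L)` and `L𝒟_{k+1} = 𝒟⁰_{k+1}` -/

section PolymerScaling

variable {S₀ S₁ : Type*}

/-- **The scaled-down functional** `F_{L^{−1}}(X, φ) = F(LX, φ_L)` (part I §3.4 L1389–1393 *"for F ∈ 𝒦⁰_{k+1} define the
scaled down F_{L^{−1}}(X, φ) = F(LX, φ_L)"*; part II §3.15: `(ℬE_k)_{L^{−1}}` L5743, `(E^#_k)_{L^{−1}}` L5752,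
`[(R^#_k)_{L^{−1}}]_{𝚷⁺}` L5757, `[(B^#_k)_{L^{−1}}]_{𝚷⁺}` L5774). [cite: Dimock2013, §3.4 (arXiv:1108.1335v2 TeX L1389–1393);
Dimock2013BalabanII, §3.15 (arXiv:1212.5562v2 TeX L5731–5778)] -/
def scaledDown (σ : S₁ ≃ S₀) (c : ℝ) (F : Finset S₀ → (S₀ → ℝ) → ℝ) : Finset S₁ → (S₁ → ℝ) → ℝ :=
  fun X φ => F (X.map σ.toEmbedding) (scaleField c σ φ)

/-- `F_{L^{−1}}(X, φ) = F(LX, φ_L)`, unfolded. [cite: Dimock2013, §3.4 (arXiv:1108.1335v2 TeX L1389–1393)] -/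
@[simp] theorem scaledDown_apply (σ : S₁ ≃ S₀) (c : ℝ) (F : Finset S₀ → (S₀ → ℝ) → ℝ) (X : Finset S₁)
    (φ : S₁ → ℝ) : scaledDown σ c F X φ = F (X.map σ.toEmbedding) (scaleField c σ φ) := rfl

/-- **The general monomial**: `∫_{LX} φ_L^n = L³cⁿ ∫_X φⁿ` (`c = L^{−1/2}`: the canonical dimension count `L^{3−n/2}`; `n =
0, 2, 4` are `vol_scale`, `nsq_scale`, `quart_scale`). [cite: Dimock2013, Lemma 5 (scaling) proof (arXiv:1108.1335v2 TeX
L814) and §4.7 (TeX L2547–2555)] -/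
theorem pow_scale {L η₀ η₁ : ℝ} (c : ℝ) (hη : η₀ = L * η₁) (σ : S₁ ≃ S₀) (X : Finset S₁) (φ : S₁ → ℝ) (n : ℕ) :
    ∑ x ∈ X.map σ.toEmbedding, η₀ ^ 3 * scaleField c σ φ x ^ n
      = L ^ 3 * c ^ n * ∑ y ∈ X, η₁ ^ 3 * φ y ^ n := by
  rw [Finset.sum_map, Finset.mul_sum]
  refine Finset.sum_congr rfl fun y _ => ?_
  rw [Equiv.coe_toEmbedding, scaleField_apply, hη]
  ring

/-- The even monomials with the constant eliminated: `L^m ∫_{LX} φ_L^{2m} = L³ ∫_X φ^{2m}` (`(c²L)^m = 1`) — `m = 0, 1, 2, 3`: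
relevant `L³, L², L¹` and marginal `L⁰`. [cite: Dimock2013, Lemma 5 (scaling) proof (arXiv:1108.1335v2 TeX L814) and §4.7
(TeX L2547–2555)] -/
theorem pow_scale_even {L η₀ η₁ c : ℝ} (hη : η₀ = L * η₁) (hc : c ^ 2 * L = 1) (σ : S₁ ≃ S₀) (X : Finset S₁)
    (φ : S₁ → ℝ) (m : ℕ) :
    L ^ m * ∑ x ∈ X.map σ.toEmbedding, η₀ ^ 3 * scaleField c σ φ x ^ (2 * m)
      = L ^ 3 * ∑ y ∈ X, η₁ ^ 3 * φ y ^ (2 * m) := by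
  rw [pow_scale c hη σ X φ (2 * m)]
  have h1 : L ^ m * c ^ (2 * m) = 1 := by
    rw [pow_mul, ← mul_pow, mul_comm, hc, one_pow]
  calc L ^ m * (L ^ 3 * c ^ (2 * m) * ∑ y ∈ X, η₁ ^ 3 * φ y ^ (2 * m))
      = (L ^ m * c ^ (2 * m)) * (L ^ 3 * ∑ y ∈ X, η₁ ^ 3 * φ y ^ (2 * m)) := by ring
    _ = L ^ 3 * ∑ y ∈ X, η₁ ^ 3 * φ y ^ (2 * m) := by rw [h1, one_mul]

/-- `LX ⊂ LΛ ⟺ X ⊂ Λ` — the relabelling of §3.15 preserves inclusions of regions (*"Ω_j a union of L^{−(k−j)}M blocks … is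
relabeled as LΩ_j"*). [cite: Dimock2013BalabanII, §3.15 (arXiv:1212.5562v2 TeX L5674–5678, L5738)] -/
theorem map_subset_map_iff (σ : S₁ ↪ S₀) (X Λ : Finset S₁) : X.map σ ⊆ Λ.map σ ↔ X ⊆ Λ :=
  Finset.map_subset_map

variable [DecidableEq S₀] [DecidableEq S₁]

/-- `LX # LΛ ⟺ X # Λ` (crossing is a statement about the two intersections, preserved by the relabelling).
[cite: Dimock2013BalabanII, §3.1 (arXiv:1212.5562v2 TeX L1756–1761) and §3.15 (TeX L5762–5777)] -/
theorem crosses_map_iff (σ : S₁ ↪ S₀) (X Λ : Finset S₁) :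
    LocalizedExtraction.Crosses (X.map σ) (Λ.map σ) ↔ LocalizedExtraction.Crosses X Λ := by
  unfold LocalizedExtraction.Crosses
  rw [← Finset.map_inter, Finset.map_nonempty, Finset.map_subset_map]

omit [DecidableEq S₁] in
/-- **`L𝒟_{k+1} = 𝒟⁰_{k+1}` as a reindexing of polymer sums** (L5738 *"since L𝒟_{k+1} = 𝒟⁰_{k+1}"*, L5778 *"we have used
that L𝒟_{k+1}(mod Ω^c_{k+1}) = 𝒟⁰_{k+1}(mod LΩ^c_{k+1})"*): with the coarse family the image of the fine one under `X ↦ LX`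
and a selection predicate transported along the relabelling (`p₀(LX) ⟺ p₁(X)`: inclusion in `LΛ`, crossing `LΛ`, …), a sum
over the selected coarse polymers is the sum over the selected fine polymers of the values at `LX`.
[cite: Dimock2013BalabanII, §3.15 (arXiv:1212.5562v2 TeX L5731–5778)] -/
theorem polymer_sum_scale (σ : S₁ ≃ S₀) (D : Finset (Finset S₁)) (p₀ : Finset S₀ → Prop) (p₁ : Finset S₁ → Prop)
    [DecidablePred p₀] [DecidablePred p₁] (hp : ∀ X, p₀ (X.map σ.toEmbedding) ↔ p₁ X) (G : Finset S₀ → ℝ) :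
    ∑ Y ∈ (D.image fun X => X.map σ.toEmbedding).filter p₀, G Y
      = ∑ X ∈ D.filter p₁, G (X.map σ.toEmbedding) := by
  rw [Finset.filter_image, Finset.sum_image fun X _ Y _ h => Finset.map_injective _ h]
  exact Finset.sum_congr (Finset.filter_congr fun X _ => hp X) fun _ _ => rfl

/-- **The reblocked small-field action scales** (L5739–5745): `E_k(LΛ_k, φ_{k+1,𝛀′,L}) = Σ_{Y∈𝒟⁰_{k+1}, Y⊂LΛ_k}(ℬE_k)(Y, φ_L) =
Σ_{X∈𝒟_{k+1}, X⊂Λ_k}(ℬE_k)(LX, φ_L) = Σ_{X∈𝒟_{k+1}, X⊂Λ_k}(ℬE_k)_{L^{−1}}(X, φ) ≡ (ℬE_k)_{L^{−1}}(Λ_k, φ)"* — and likewise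
`E^#_k` (L5748–5753), `R^#_k` (L5754–5758); the reblocking `ℬ` itself is `Reblocking` (LEMMA citizen), by name.
[cite: Dimock2013BalabanII, §3.15 (arXiv:1212.5562v2 TeX L5731–5758)] -/
theorem sum_inside_scale (σ : S₁ ≃ S₀) (c : ℝ) (D : Finset (Finset S₁)) (Λ : Finset S₁)
    (F : Finset S₀ → (S₀ → ℝ) → ℝ) (φ : S₁ → ℝ) :
    ∑ Y ∈ (D.image fun X => X.map σ.toEmbedding).filter (· ⊆ Λ.map σ.toEmbedding), F Y (scaleField c σ φ)
      = ∑ X ∈ D.filter (· ⊆ Λ), scaledDown σ c F X φ :=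
  polymer_sum_scale σ D (· ⊆ Λ.map σ.toEmbedding) (· ⊆ Λ) (fun _ => Finset.map_subset_map) _

/-- **The reblocked boundary term scales** (L5762–5777): `B^#_{k,L𝚷⁺}(LΛ_{k+1}, …_L) = Σ_{Y∈𝒟⁰_{k+1}(mod LΩ^c_{k+1}), Y#LΛ_{k+1}}
(B^#_{k,L𝚷⁺})(Y, …_L) = Σ_{X∈𝒟_{k+1}(mod Ω^c_{k+1}), X#Λ_{k+1}} [(B^#_k)_{L^{−1}}]_{𝚷⁺}(X, …) ≡ [(B^#_k)_{L^{−1}}]_{𝚷⁺}(Λ_{k+1}, …)"*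
— the modulo-holes family transported as the image family, the crossing condition by `crosses_map_iff`.
[cite: Dimock2013BalabanII, §3.15 (arXiv:1212.5562v2 TeX L5760–5778)] -/
theorem sum_crossing_scale (σ : S₁ ≃ S₀) (c : ℝ) (Dmod : Finset (Finset S₁)) (Λ : Finset S₁)
    (F : Finset S₀ → (S₀ → ℝ) → ℝ) (φ : S₁ → ℝ) :
    ∑ Y ∈ (Dmod.image fun X => X.map σ.toEmbedding).filter
        (LocalizedExtraction.Crosses · (Λ.map σ.toEmbedding)), F Y (scaleField c σ φ)
      = ∑ X ∈ Dmod.filter (LocalizedExtraction.Crosses · Λ), scaledDown σ c F X φ :=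
  polymer_sum_scale σ Dmod (LocalizedExtraction.Crosses · (Λ.map σ.toEmbedding)) (LocalizedExtraction.Crosses · Λ)
    (fun X => crosses_map_iff σ.toEmbedding X Λ) _

end PolymerScaling

/-! ## Part 9 — §3.18's `B^{*,(2)}` = `𝒯`-term estimate assembled (L6365–6407) -/

section TTermEstimate

/-- **One relevant part times one restricted field functional** (the pattern of L6391–6401): a coefficient bounded by
`A·Vol(X)^{−1}·K·λ^p·e` (print: `|α(E^*_k, X)| ≤ 𝒪(1)Vol(X)^{−1}L³λ^{β+…}e^{−2κd_M(X)}`, L6392–6396) times a field functional on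
`X ∩ Λ` bounded by `B·Vol(X ∩ Λ)·λ^q` (L6398–6399: `‖φ‖²_{X∩Λ} ≤ 𝒪(1)Vol(X ∩ Λ)λ^{−½−4δ}`) is at most `A·B·K·λ^β·e` once
`Vol(X ∩ Λ) ≤ Vol(X)` (`Vol(X) > 0`), `0 < λ ≤ 1` and the exponents add up to at least `β`. [cite: Dimock2013BalabanII, §3.18
(arXiv:1212.5562v2 TeX L6391–6401)] -/
theorem coeff_mul_field_le {a x A B VX VXΛ K lam p q β e : ℝ} (hlam : 0 < lam) (hlam1 : lam ≤ 1)
    (hVX : 0 < VX) (hV : VXΛ ≤ VX) (hA : 0 ≤ A) (hB : 0 ≤ B) (hK : 0 ≤ K) (he : 0 ≤ e)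
    (hpq : β ≤ p + q) (ha : |a| ≤ A * VX⁻¹ * K * lam ^ p * e) (hx : |x| ≤ B * VXΛ * lam ^ q) :
    |a * x| ≤ A * B * K * lam ^ β * e := by
  rw [abs_mul]
  have hratio : VX⁻¹ * VXΛ ≤ 1 := by
    rw [inv_mul_le_iff₀ hVX, mul_one]
    exact hV
  have hpow : lam ^ p * lam ^ q ≤ lam ^ β := by
    rw [← Real.rpow_add hlam]
    exact Real.rpow_le_rpow_of_exponent_ge hlam hlam1 hpq
  have hVXi : 0 ≤ VX⁻¹ := inv_nonneg.2 hVX.le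
  calc |a| * |x| ≤ (A * VX⁻¹ * K * lam ^ p * e) * (B * VXΛ * lam ^ q) :=
        mul_le_mul ha hx (abs_nonneg _) (by positivity)
    _ = (A * B * K * e) * ((VX⁻¹ * VXΛ) * (lam ^ p * lam ^ q)) := by ring
    _ ≤ (A * B * K * e) * (1 * lam ^ β) := by
        refine mul_le_mul_of_nonneg_left ?_ (by positivity)
        exact mul_le_mul hratio hpow (by positivity) zero_le_one
    _ = A * B * K * lam ^ β * e := by ring

/-- **The `B^{*,(2)}` estimate** (L6380–6401): for `X ∈ 𝒮`, `X # Λ_{k+1}`, with `B^{*,(2)}(X) = 𝒯_{Λ_{k+1}}E^*_k(X) =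
α₀(E^*_k,X)Vol(Λ_{k+1} ∩ X) + α₂(E^*_k,X)‖φ‖²_{X∩Λ_{k+1}} + Σ_μ α_{2,μ}(E^*_k,X)∫_{X∩Λ_{k+1}}φ∂_μφ` (L6383–6389 — the shape
`LocalizedExtraction.bdryT`), the three coefficient bounds L6392–6396 (*"|α₀(E^*_k,X)| ≤ 𝒪(1)Vol(X)^{−1}L³λ^βe^{−2κd_M(X)},
|α₂(E^*_k,X)| ≤ 𝒪(1)Vol(X)^{−1}L³λ^{β+½+6ε}e^{−2κd_M(X)}, |α_{2,μ}(E^*_k,X)| ≤ 𝒪(1)Vol(X)^{−1}L³λ^{β+½+5ε}e^{−2κd_M(X)}"*, from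
(estar) — HYPOTHESES here) and the field bounds L6398–6399 (*"‖φ_{k+1,𝛀′}‖²_{X∩Λ_{k+1}} ≤ 𝒪(1)Vol(X ∩ Λ_{k+1})λ^{−½−4δ}.
The same bound holds for ∫_{X∩Λ_{k+1}}φ∂_μφ"* — HYPOTHESES) give, *"since 2δ < ε"*, **`|B^{*,(2)}(X)| ≤ 𝒪(1)L³λ^βe^{−2κd_M(X)}`**
(L6400–6401) with `𝒪(1) = c + 4cc′` explicit (`c` the coefficient constant, `c′` the field constant; three directions `μ`).
[cite: Dimock2013BalabanII, §3.18 (arXiv:1212.5562v2 TeX L6365–6401)] -/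
theorem Bstar2_bound {c c' L lam β ε δ κ d VX VXΛ α₀ α₂ N : ℝ} {α₂μ W : Fin 3 → ℝ}
    (hlam : 0 < lam) (hlam1 : lam ≤ 1) (hε : 0 ≤ ε) (hδε : 2 * δ ≤ ε) (hL : 0 ≤ L) (hc : 0 ≤ c) (hc' : 0 ≤ c')
    (hVX : 0 < VX) (hVXΛ : 0 ≤ VXΛ) (hV : VXΛ ≤ VX)
    (h0 : |α₀| ≤ c * VX⁻¹ * L ^ 3 * lam ^ β * Real.exp (-(2 * κ) * d))
    (h2 : |α₂| ≤ c * VX⁻¹ * L ^ 3 * lam ^ (β + 1 / 2 + 6 * ε) * Real.exp (-(2 * κ) * d))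
    (h2μ : ∀ μ, |α₂μ μ| ≤ c * VX⁻¹ * L ^ 3 * lam ^ (β + 1 / 2 + 5 * ε) * Real.exp (-(2 * κ) * d))
    (hN : |N| ≤ c' * VXΛ * lam ^ (-1 / 2 - 4 * δ))
    (hW : ∀ μ, |W μ| ≤ c' * VXΛ * lam ^ (-1 / 2 - 4 * δ)) :
    |α₀ * VXΛ + α₂ * N + ∑ μ, α₂μ μ * W μ|
      ≤ (c + 4 * c * c') * L ^ 3 * lam ^ β * Real.exp (-(2 * κ) * d) := by
  have hK : 0 ≤ L ^ 3 := pow_nonneg hL 3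
  have he : 0 ≤ Real.exp (-(2 * κ) * d) := (Real.exp_pos _).le
  -- the volume term: coefficient × Vol(X ∩ Λ) (exponents β + 0)
  have t0 : |α₀ * VXΛ| ≤ c * 1 * L ^ 3 * lam ^ β * Real.exp (-(2 * κ) * d) := by
    refine coeff_mul_field_le (p := β) (q := 0) hlam hlam1 hVX hV hc zero_le_one hK he (by simp) h0 ?_
    rw [Real.rpow_zero, abs_of_nonneg hVXΛ]
    simp
  -- the mass term: exponents (β + ½ + 6ε) + (−½ − 4δ) ≥ β since 4δ ≤ 2ε ≤ 6ε
  have t2 : |α₂ * N| ≤ c * c' * L ^ 3 * lam ^ β * Real.exp (-(2 * κ) * d) :=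
    coeff_mul_field_le hlam hlam1 hVX hV hc hc' hK he (by linarith) h2 hN
  -- the marginal terms: exponents (β + ½ + 5ε) + (−½ − 4δ) ≥ β since 4δ ≤ 2ε ≤ 5ε
  have tμ : ∀ μ, |α₂μ μ * W μ| ≤ c * c' * L ^ 3 * lam ^ β * Real.exp (-(2 * κ) * d) := fun μ =>
    coeff_mul_field_le hlam hlam1 hVX hV hc hc' hK he (by linarith) (h2μ μ) (hW μ)
  have tsum : |∑ μ, α₂μ μ * W μ| ≤ 3 * (c * c' * L ^ 3 * lam ^ β * Real.exp (-(2 * κ) * d)) :=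
    calc |∑ μ, α₂μ μ * W μ| ≤ ∑ μ, |α₂μ μ * W μ| := Finset.abs_sum_le_sum_abs _ _
      _ ≤ ∑ _μ : Fin 3, c * c' * L ^ 3 * lam ^ β * Real.exp (-(2 * κ) * d) := Finset.sum_le_sum fun μ _ => tμ μ
      _ = 3 * (c * c' * L ^ 3 * lam ^ β * Real.exp (-(2 * κ) * d)) := by
          simp only [Finset.sum_const, Finset.card_univ, Fintype.card_fin, nsmul_eq_mul, Nat.cast_ofNat]
  calc |α₀ * VXΛ + α₂ * N + ∑ μ, α₂μ μ * W μ|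
      ≤ |α₀ * VXΛ| + |α₂ * N| + |∑ μ, α₂μ μ * W μ| := abs_add_three _ _ _
    _ ≤ c * 1 * L ^ 3 * lam ^ β * Real.exp (-(2 * κ) * d) + c * c' * L ^ 3 * lam ^ β * Real.exp (-(2 * κ) * d)
          + 3 * (c * c' * L ^ 3 * lam ^ β * Real.exp (-(2 * κ) * d)) := add_le_add (add_le_add t0 t2) tsum
    _ = (c + 4 * c * c') * L ^ 3 * lam ^ β * Real.exp (-(2 * κ) * d) := by ring

/-- **… and its `¼B₀` form** (L6405–6407 *"|(B^{*(2)}_{k+1,𝚷⁺})′(Z)| ≤ ¼B₀λ^βe^{−κd_M(Z, mod Ω^c_{k+1})}"*, the rate `2κ ≥ κ`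
surviving the localization up to the print's *"as before"*): the un-localized piece already satisfies the `¼B₀` bound by
`BoundaryTermLedger.new_term_fraction` at `θ = ¼`, `κ′ = 2κ`, once `(c + 4cc′)L³ ≤ ¼B₀` (*"We have assumed B₀ is
sufficiently large so that 𝒪(1)L³ ≤ ¼B₀"*, L6344).  The localization itself (a decoupling expansion) and the replacement
`d_M(X) ↦ d_M(X, mod Ω^c_{k+1})` (L6403–6404) are not typed. [cite: Dimock2013BalabanII, §3.18 (arXiv:1212.5562v2 TeX
L6400–6407, L6344)] -/
theorem Bstar2_quarter {v C L B₀ β κ d lam : ℝ} (hlam : 0 < lam) (hd : 0 ≤ d) (hκ : 0 ≤ κ)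
    (hv : |v| ≤ C * L ^ 3 * lam ^ β * Real.exp (-(2 * κ) * d)) (hC : 0 ≤ C * L ^ 3)
    (hB₀ : C * L ^ 3 ≤ (1 / 4) * B₀) :
    |v| ≤ (1 / 4) * B₀ * lam ^ β * Real.exp (-κ * d) :=
  BoundaryTermLedger.new_term_fraction hlam hd hv hC hB₀ (by linarith)

end TTermEstimate

/-! ## Part 10 — «Q is scale invariant» and «S^{*,0}_{k+1} scales to S^*_{k+1}» ((oooo); part I (71); §3.15 L5711–5717) -/

section ActionScaling

variable {S₀ S₁ : Type*}

/-- Scaling is linear: `(Φ − ψ)_L = Φ_L − ψ_L`. [cite: Dimock2013, Lemma 5 (scaling) proof (arXiv:1108.1335v2 TeX L814)] -/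
theorem scaleField_sub (c : ℝ) (σ : S₁ ≃ S₀) (Φ ψ : S₁ → ℝ) :
    scaleField c σ (fun y => Φ y - ψ y) = fun x => scaleField c σ Φ x - scaleField c σ ψ x := by
  funext x
  simp only [scaleField]
  ring

variable {S₀' S₁' : Type*}

/-- **The block average** `(Qφ)(y) = w·Σ_{x∈B(y)} φ(x)` (part I §2.1: `(Qf)(y) = L^{−3}Σ_{x∈B(y)} f(x)`; here with the block
map `B` from block sites to sets of sites and the weight `w` abstract — `Q_k`, `Q_{k+1}`, `Q_{k,𝛀}` are instances).
[cite: Dimock2013, §2.1 (arXiv:1108.1335v2 TeX L311–340)] -/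
def blockAvg (B : S₀' → Finset S₀) (w : ℝ) (φ : S₀ → ℝ) : S₀' → ℝ := fun y => w * ∑ x ∈ B y, φ x

/-- **«Q is scale invariant: Qφ_L = (Qφ)_L»** (part I L411; L814 *"The averaging operator Q is scale invariant"*; part II L922
*"Q_j is scale invariant"*): when the blocks are transported by the relabellings (`B₀(σ′y) = σ(B₁(y))`), averaging the scaled
field is scaling the averaged field. [cite: Dimock2013, §2.1 (arXiv:1108.1335v2 TeX L411) and Lemma 5 (scaling) proof
(TeX L814); Dimock2013BalabanII, §2.3 (arXiv:1212.5562v2 TeX L920–922)] -/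
theorem blockAvg_scale (σ : S₁ ≃ S₀) (σ' : S₁' ≃ S₀') (B₀ : S₀' → Finset S₀) (B₁ : S₁' → Finset S₁)
    (hB : ∀ y, B₀ (σ' y) = (B₁ y).map σ.toEmbedding) (w c : ℝ) (φ : S₁ → ℝ) :
    blockAvg B₀ w (scaleField c σ φ) = scaleField c σ' (blockAvg B₁ w φ) := by
  funext x
  obtain ⟨y, rfl⟩ := σ'.surjective x
  rw [scaleField_apply]
  unfold blockAvg
  rw [hB, Finset.sum_map]
  simp only [Equiv.coe_toEmbedding, scaleField_apply]
  rw [← Finset.mul_sum]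
  ring

/-- **The `Q`-term reindexed**: `‖Φ_L − Qφ_L‖²_{LX′} = L²‖Φ − Qφ‖²_{X′}` — `blockAvg_scale` + linearity + `nsq_scale` on the
block-site lattices (`η₀′ = Lη₁′`, blocks transported, `c²L = 1`). [cite: Dimock2013, Lemma 5 (scaling) eq. (71)
(arXiv:1108.1335v2 TeX L831–841); Dimock2013BalabanII, §2.3 eq. (oooo) (arXiv:1212.5562v2 TeX L939–943)] -/
theorem Qterm_nsq_scale {L η₀' η₁' c : ℝ} (hη' : η₀' = L * η₁') (hc : c ^ 2 * L = 1) (σ : S₁ ≃ S₀)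
    (σ' : S₁' ≃ S₀') (B₀ : S₀' → Finset S₀) (B₁ : S₁' → Finset S₁)
    (hB : ∀ y, B₀ (σ' y) = (B₁ y).map σ.toEmbedding) (w : ℝ) (X' : Finset S₁') (Φ : S₁' → ℝ) (φ : S₁ → ℝ) :
    nsq η₀' (X'.map σ'.toEmbedding) (fun x => scaleField c σ' Φ x - blockAvg B₀ w (scaleField c σ φ) x)
      = L ^ 2 * nsq η₁' X' (fun y => Φ y - blockAvg B₁ w φ y) := by
  rw [blockAvg_scale σ σ' B₀ B₁ hB w c φ, ← scaleField_sub, nsq_scale hη' hc]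

/-- **The `Q`-term of the action scales**: `(a/L²)‖Φ_L − Qφ_L‖²_{LX′} = a‖Φ − Qφ‖²_{X′}` (part I L834–839 `½(a_{k+1}/L²)‖Φ_{k+1,L}
− Q_{k+1}φ_{k+1,L}‖² = ½a_{k+1}‖Φ_{k+1} − Q_{k+1}φ_{k+1}‖²`; part II (oooo) and §3.15 L5714–5716), for block-site lattices
related by `σ′` with spacings `η₀′ = Lη₁′`, blocks transported, `c²L = 1`, `L ≠ 0`. [cite: Dimock2013, Lemma 5 (scaling)
eq. (71) (arXiv:1108.1335v2 TeX L831–841); Dimock2013BalabanII, §2.3 eq. (oooo) (arXiv:1212.5562v2 TeX L939–943) and §3.15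
(TeX L5711–5717)] -/
theorem Qterm_scale {L η₀' η₁' c : ℝ} (hη' : η₀' = L * η₁') (hc : c ^ 2 * L = 1) (hL : L ≠ 0) (σ : S₁ ≃ S₀)
    (σ' : S₁' ≃ S₀') (B₀ : S₀' → Finset S₀) (B₁ : S₁' → Finset S₁)
    (hB : ∀ y, B₀ (σ' y) = (B₁ y).map σ.toEmbedding) (w a : ℝ) (X' : Finset S₁') (Φ : S₁' → ℝ) (φ : S₁ → ℝ) :
    a / L ^ 2 * nsq η₀' (X'.map σ'.toEmbedding)
        (fun x => scaleField c σ' Φ x - blockAvg B₀ w (scaleField c σ φ) x)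
      = a * nsq η₁' X' (fun y => Φ y - blockAvg B₁ w φ y) := by
  rw [Qterm_nsq_scale hη' hc σ σ' B₀ B₁ hB w X' Φ φ]
  field_simp

/-- **«S^{*,0}_{k+1}(LΛ_k, Φ_{k+1,𝛀⁺,L}, φ_{k+1,𝛀′,L}) = S^*_{k+1}(Λ_k, Φ_{k+1,𝛀⁺}, φ_{k+1,𝛀′})»** (§3.15 L5711–5717; (oooo) L939–943;
part I (71) L831–841) for the four-term action of LEMMA 2.5 (L1069–1075): `S^{*,0}_{k+1}(Λ, Φ_{k+1}, Φ_k, φ) = (a_{k+1}/2L²)‖Φ_{k+1} −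
Q_{k+1}φ‖²_{Ω_{k+1}} + (a_k/2)‖Φ_k − Q_kφ‖²_{Λ−Ω_{k+1}} + ½‖∂φ‖²_{*,Λ} + ½μ̄_k‖φ‖²_Λ` — each field on its own lattice (`Φ_{k+1}`
on the `L`-lattice ∕ unit lattice, `Φ_k` on the unit ∕ `L^{−1}`-lattice, `φ` on `𝕋^{−k}` ∕ `𝕋^{−(k+1)}`), each pair related by
its relabelling with spacings in ratio `L`, blocks and forward bonds transported, the same constant `c` (`c²L = 1`) for every
field, `μ̄_kL² = μ̄_{k+1}` and `a^{(k)}_kL² = a^{(k+1)}_k` (L921–922): the scaled action EQUALS `(a_{k+1}/2)‖Φ_{k+1} − Q_{k+1}φ‖² +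
(a_kL²/2)‖Φ_k − Q_kφ‖² + ½‖∂φ‖² + ½μ̄_{k+1}‖φ‖²`. [cite: Dimock2013BalabanII, §3.15 (arXiv:1212.5562v2 TeX L5711–5717), §2.3
Lemma 2.5 and eq. (oooo) (TeX L1069–1084, L920–943); Dimock2013, Lemma 5 eq. (71) (arXiv:1108.1335v2 TeX L831–841)] -/
theorem Sstar0_scale {U₀ U₁ V₀ V₁ : Type*} {L c ηS₀ ηS₁ ηU₀ ηU₁ ηV₀ ηV₁ mubar mubar1 : ℝ}
    (hηS : ηS₀ = L * ηS₁) (hηU : ηU₀ = L * ηU₁) (hηV : ηV₀ = L * ηV₁) (hc : c ^ 2 * L = 1) (hL : L ≠ 0)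
    (hmu : mubar * L ^ 2 = mubar1)
    (σ : S₁ ≃ S₀) (σU : U₁ ≃ U₀) (σV : V₁ ≃ V₀)
    (BU₀ : U₀ → Finset S₀) (BU₁ : U₁ → Finset S₁) (hBU : ∀ y, BU₀ (σU y) = (BU₁ y).map σ.toEmbedding)
    (BV₀ : V₀ → Finset S₀) (BV₁ : V₁ → Finset S₁) (hBV : ∀ y, BV₀ (σV y) = (BV₁ y).map σ.toEmbedding)
    (τ₀ : S₀ → S₀) (τ₁ : S₁ → S₁) (hτ : ∀ y, σ (τ₁ y) = τ₀ (σ y))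
    (wU wV a₁ a₀ : ℝ) (Ω : Finset U₁) (ΛV : Finset V₁) (Bd Λ : Finset S₁)
    (Φ₁ : U₁ → ℝ) (Φ₀ : V₁ → ℝ) (φ : S₁ → ℝ) :
    a₁ / L ^ 2 / 2 * nsq ηU₀ (Ω.map σU.toEmbedding)
          (fun x => scaleField c σU Φ₁ x - blockAvg BU₀ wU (scaleField c σ φ) x)
        + a₀ / 2 * nsq ηV₀ (ΛV.map σV.toEmbedding)
          (fun x => scaleField c σV Φ₀ x - blockAvg BV₀ wV (scaleField c σ φ) x)
        + 1 / 2 * gradsq τ₀ ηS₀ (Bd.map σ.toEmbedding) (scaleField c σ φ)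
        + 1 / 2 * mubar * nsq ηS₀ (Λ.map σ.toEmbedding) (scaleField c σ φ)
      = a₁ / 2 * nsq ηU₁ Ω (fun y => Φ₁ y - blockAvg BU₁ wU φ y)
        + a₀ * L ^ 2 / 2 * nsq ηV₁ ΛV (fun y => Φ₀ y - blockAvg BV₁ wV φ y)
        + 1 / 2 * gradsq τ₁ ηS₁ Bd φ
        + 1 / 2 * mubar1 * nsq ηS₁ Λ φ := by
  rw [Qterm_nsq_scale hηU hc σ σU BU₀ BU₁ hBU wU Ω Φ₁ φ, Qterm_nsq_scale hηV hc σ σV BV₀ BV₁ hBV wV ΛV Φ₀ φ,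
    gradsq_scale hηS hc hL σ τ₀ τ₁ hτ Bd φ, nsq_scale hηS hc σ Λ φ, ← hmu]
  field_simp

/-- **Part I's LEMMA 5 (scaling), eq. (71)**: *"S⁰_{k+1}(Φ_{k+1,L}, φ_{k+1,L}) = ½(a_{k+1}/L²)‖Φ_{k+1,L} − Q_{k+1}φ_{k+1,L}‖² +
½‖∂φ_{k+1,L}‖² + ½μ̄_k‖φ_{k+1,L}‖² = ½a_{k+1}‖Φ_{k+1} − Q_{k+1}φ_{k+1}‖² + ½‖∂φ_{k+1}‖² + ½μ̄_{k+1}‖φ_{k+1}‖² = S_{k+1}(Φ_{k+1},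
φ_{k+1})"* (L831–841; *"μ̄_k = L^{−2}μ̄_{k+1}"* L815) — the three-term, one-block-structure case of `Sstar0_scale`.
[cite: Dimock2013, Lemma 5 (scaling) eq. (71) (arXiv:1108.1335v2 TeX L814–848)] -/
theorem S0_scale {U₀ U₁ : Type*} {L c ηS₀ ηS₁ ηU₀ ηU₁ mubar mubar1 : ℝ}
    (hηS : ηS₀ = L * ηS₁) (hηU : ηU₀ = L * ηU₁) (hc : c ^ 2 * L = 1) (hL : L ≠ 0) (hmu : mubar * L ^ 2 = mubar1)
    (σ : S₁ ≃ S₀) (σU : U₁ ≃ U₀) (BU₀ : U₀ → Finset S₀) (BU₁ : U₁ → Finset S₁)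
    (hBU : ∀ y, BU₀ (σU y) = (BU₁ y).map σ.toEmbedding) (τ₀ : S₀ → S₀) (τ₁ : S₁ → S₁)
    (hτ : ∀ y, σ (τ₁ y) = τ₀ (σ y)) (wU a : ℝ) (Ω : Finset U₁) (Bd Λ : Finset S₁) (Φ : U₁ → ℝ) (φ : S₁ → ℝ) :
    1 / 2 * (a / L ^ 2) * nsq ηU₀ (Ω.map σU.toEmbedding)
          (fun x => scaleField c σU Φ x - blockAvg BU₀ wU (scaleField c σ φ) x)
        + 1 / 2 * gradsq τ₀ ηS₀ (Bd.map σ.toEmbedding) (scaleField c σ φ)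
        + 1 / 2 * mubar * nsq ηS₀ (Λ.map σ.toEmbedding) (scaleField c σ φ)
      = 1 / 2 * a * nsq ηU₁ Ω (fun y => Φ y - blockAvg BU₁ wU φ y)
        + 1 / 2 * gradsq τ₁ ηS₁ Bd φ
        + 1 / 2 * mubar1 * nsq ηS₁ Λ φ := by
  rw [Qterm_nsq_scale hηU hc σ σU BU₀ BU₁ hBU wU Ω Φ φ, gradsq_scale hηS hc hL σ τ₀ τ₁ hτ Bd φ,
    nsq_scale hηS hc σ Λ φ, ← hmu]
  field_simp

end ActionScaling

/-! ## Part 7 — Non-vacuity -/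

/-- Two-point lattices, `σ` the identity relabelling, `L = 4`, `c = ½` (`c²L = 1`), `η₀ = 4η₁` with `η₁ = 1`: the quartic
sum of the scaled field is `4 = L` times the fine one (`φ ≡ 1`: fine `Σ = 2`, coarse `Σ = 64·(1/16)·2 = 8 = 4·2`). -/
example : quart (4 : ℝ) ((Finset.univ : Finset (Fin 2)).map (Equiv.refl (Fin 2)).toEmbedding)
      (scaleField (1 / 2) (Equiv.refl (Fin 2)) fun _ => 1)
    = 4 * quart 1 (Finset.univ : Finset (Fin 2)) (fun _ => (1 : ℝ)) :=
  quart_scale (L := 4) (by norm_num) (by norm_num) _ _ _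

/-- The history product at `k = 1` with `t ≡ 0` is `1`, and `Z₂ = z₀z₁`. -/
example : Kprod (fun _ => 0) 1 = 1 ∧ Zseq (fun j => (j : ℝ) + 2) 2 = 2 * 3 :=
  ⟨by simp [Kprod], by norm_num [Zseq]⟩

end Literature.MathematicalPhysics.QuantumFieldTheory.Dimock2011to13.LocalizedStepAssembly

end
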